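import Mathlib
import Literature.LinearAlgebra.Matrix.SkewNormalForm
import Literature.MathematicalPhysics.QuantumLattice.FermionOperatorsProofs
import Literature.MathematicalPhysics.QuantumLattice.HubbardModelParticleHoleProofs
import HarnessLib

/-!
# Yang's bound on the two-particle reduced density matrix (hubbard.S07)

Sibling proof file of `Literature/MathematicalPhysics/QuantumLattice/HubbardWave0.lean`
(family `hubbard`, trunk T-QLATTICE; the other siblings are `HubbardWave0Proofs` — the vacuum,
hubbard.S04 — and `HubbardWave0PosSemidefProofs` — `ρ₂ ≥ 0`, `tr ρ₂ = N(N - 1)`, hubbard.S06).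
Its content is the discharge of the named fact `Literature.MathematicalPhysics.QuantumLattice.twoParticleRDM_rayleigh_le`
(statement hubbard.S07) of that file,

  `theorem twoParticleRDM_rayleigh_le_holds : twoParticleRDM_rayleigh_le`,

i.e. **Yang's bound**: for every normalised `N`-fermion state `ψ` on `M = |ι|` orbitals and every
pair wavefunction `v : ι × ι → ℂ`, `Re ⟨v, ρ₂(ψ) v⟩ ≤ N(M - N + 2)/M · ‖v‖²`, so that the largest
eigenvalue of Yang's `ρ₂((i,j),(k,l)) = ⟨ψ, c†_i c†_j c_l c_k ψ⟩` is at most `N(M - N + 2)/M`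
(C. N. Yang, Rev. Mod. Phys. **34** (1962) 694, §3 and Appendix A, proved there through the
canonical form of the pair function). Everything is proved from Mathlib, `HubbardWave0`
(Jordan–Wigner matrices `annihilation`/`creation` on `Fock ι = Finset ι → ℂ`, sectors
`IsNParticle`, `twoParticleRDM`), the CAR discharges of `FermionOperatorsProofs`
(`annihilation_anticommute_holds`, `annihilation_mul_creation_add_creation_mul_annihilation_holds`,
`star_jwSign`), the coordinate formulas `annihilation_mulVec_apply` / `creation_mulVec_apply` of
`HubbardModelParticleHoleProofs`, `FermionOperators` (`Literature.MathematicalPhysics.QuantumLattice.totalNumberOp_eq_diagonal`)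
and `Literature/LinearAlgebra/Matrix/SkewNormalForm` (normal form of a skew-symmetric matrix).
No statement of those files is changed. The discharge is `Literature.MathematicalPhysics.QuantumLattice.twoParticleRDM_rayleigh_le_holds`;
all auxiliary declarations live in the namespace `Literature.Hubbard.RayleighBound` (to keep the shared
`Literature.Hubbard` namespace free for the sibling Proofs files), except the particle-number
bookkeeping lemmas `Literature.Hubbard.IsNParticle.*` (dot notation on `IsNParticle`). The hypothesis
`Even N` of the named fact is not needed by the proof (for odd `N` the bound holds but is not
sharp); `N ≤ M` is only used through the sign `N(M - N + 2)/M ≥ 0` of the coefficient.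

## Contents (namespace `Literature.Hubbard.RayleighBound`)

* The coordinate formula for `c_i c_j ψ` (`annihilation_mul_annihilation_mulVec_apply`).
* Smeared operators `annihilate f = Σ_i conj (f i) • c_i`, `create f = (annihilate f)ᴴ`, their
  CAR (`annihilate_mul_annihilate`, `annihilate_mul_create_add`), mode number operators
  `numberMode f = c†(f) c(f)` and their algebra for orthonormal modes, particle-number
  bookkeeping (`IsNParticle.annihilate_mulVec`, …), the squared norm `normSq`, and
  `Σ_k ‖c(u_k) φ‖² = n ‖φ‖²` for a complete family `u` (`IsNParticle.sum_normSq_annihilate_mulVec`).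
* Amplitudes `amp u n φ j = ⟨∅| c(u_{j(n-1)}) ⋯ c(u_{j 0}) |φ⟩` of a Fock vector on ordered
  `n`-tuples of modes of a family `u`, with linearity, the Pauli principle
  (`amp_eq_zero_of_not_injective`), insertion of the projections `n(u_k)` and `1 - n(u_k)`
  (`amp_numberMode_of_exists`, `amp_one_sub_numberMode_of_forall_ne`, …) and the norm identity
  `Σ_j |amp u n φ j|² = n! ‖φ‖²` (`sum_norm_amp_sq`) for a complete family `u`.
* The **core estimate** of Yang's bound (`normSq_pairSum_mulVec_le`): for an orthonormal basis
  `u : κ → ℂ^ι`, injective `F, G : L → κ` with disjoint ranges, weights `μ : L → ℂ` and an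
  `(m + 2)`-particle `ψ`,
  `‖(Σ_a μ_a c(u_{G a}) c(u_{F a})) ψ‖² ≤ N(M - N + 2)/(2M) · Σ_a |μ_a|² · ‖ψ‖²`
  (`N = m + 2`, `M = |κ|`).
* The assembly (last part of the file): the pair-annihilation operator
  `pairOp w = Σ_{k,l} w k l • c_l c_k`, the identity `⟨v, ρ₂ v⟩ = ‖Δ(v) ψ‖²`
  (`star_dotProduct_twoParticleRDM_mulVec`), antisymmetrisation (`pairOp_eq_pairOp_antisymm`,
  `sum_norm_sq_antisymm_le`), the Frobenius norm of a normal form (`sum_norm_sq_skewNormalForm`),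
  the orthonormal-basis extension (`exists_orthonormal_extension`, `complete_of_orthonormal`) and
  `twoParticleRDM_rayleigh_le_holds`.

## Proof of Yang's bound

1. `⟨v, ρ₂ v⟩ = ‖Δ(v) ψ‖²` with `Δ(w) = Σ_{k,l} w k l • c_l c_k`, since
   `ρ₂((i,j),(k,l)) = ⟨ψ, c†_i c†_j c_l c_k ψ⟩` and `(c_{p₂} c_{p₁})ᴴ = c†_{p₁} c†_{p₂}`.
2. By the CAR, `Δ` only sees the antisymmetric part `a = (v - vᵀ)/2` of `v`, and `‖a‖² ≤ ‖v‖²`.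
3. The normal form of the skew-symmetric matrix `a` (`Matrix.exists_skewNormalForm_of_transpose_eq_neg`,
   Horn–Johnson Cor. 4.4.19 / Youla 1961; Yang's "canonical form of the pair function"):
   `a = Σ_α σ_α (ȳ_α x̄_αᵀ - x̄_α ȳ_αᵀ)` with `(x_α, y_α)_α` orthonormal, whence
   `Δ(a) = 2 Σ_α σ_α c(x_α) c(y_α)` (`pairOp_mul_fun`) and `‖a‖² = 2 Σ_α σ_α²`.
4. Extend `(x_α, y_α)_α` to an orthonormal basis `u` of `ℂ^ι` (Mathlib's
   `Orthonormal.exists_orthonormalBasis_extension`; completeness `Σ_k u_k(i) conj (u_k(j)) = δ_ij`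
   from `Matrix.mul_eq_one_comm_of_equiv`) and apply the core estimate below:
   `‖(Σ_α σ_α c(x_α) c(y_α)) ψ‖² ≤ N(M - N + 2)/(2M) · Σ_α σ_α²`.
5. Hence `⟨v, ρ₂ v⟩ = 4 ‖(Σ_α σ_α c(x_α) c(y_α)) ψ‖² ≤ N(M - N + 2)/M · 2 Σ_α σ_α² ≤ N(M - N + 2)/M · ‖v‖²`;
   for `N < 2`, `Δ(v) ψ = 0`.

## Proof of the core estimate

Put `A_a(r) = amp ψ (F a :: G a :: r)` for `m`-tuples `r`; then
`m! ‖Bψ‖² = Σ_r |Σ_a μ_a A_a(r)|²` (`amp_pairSum_mulVec`, `sum_norm_amp_sq`) and `A_a(r) = 0`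
unless the pair `{F a, G a}` avoids `range r` (Pauli). The two Cauchy–Schwarz estimates
`|Σ_a μ_a A_a(r)|² ≤ (Σ_{b ∈ E(r)} |μ_b|²)(Σ_a |A_a(r)|²)` and `≤ |E(r)| Σ_a |μ_a|² |A_a(r)|²`,
`E(r)` the set of pairs avoiding `r` (the device of Tennie–Vedral–Schilling 2017, Appendix A,
there for hard-core bosons), are mixed with weights `θ = (M - N + 2)/M` and `1 - θ`
(`norm_sum_mul_sq_le_convex`). Inserting the projections `n(u_{F b}) n(u_{G b})` and
`(1 - n(u_{F b}))(1 - n(u_{G b}))` converts the `r`-sums into sums `Σ_j |amp ψ j|² X(j)` over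
`N`-tuples `j` (steps K3, K4, K7 of the proof), where `X(j)` only involves the number
`k(j) ≤ N/2` of complete pairs inside `range j` and the number `e(j) ≤ (M - N)/2` of pairs
outside it (`two_mul_card_fullPairs_le`, `two_mul_card_emptyPairs_add_le`, `yang_pointwise`); the
choice of `θ` makes both resulting coefficients equal to `T = N(M - N + 2)/(2M)`, and
`Σ_j |amp ψ j|² = N! ‖ψ‖²` closes the estimate.

## References

* C. N. Yang, *Concept of off-diagonal long-range order and the quantum phases of liquid He
  and of superconductors*, Rev. Mod. Phys. **34** (1962) 694–704, §3 (the bound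
  `λ_max(ρ₂) ≤ N(M - N + 2)/M`) and Appendix A (canonical form of the pair function, proof).
* F. Tennie, V. Vedral, C. Schilling, *Universal upper bounds on the Bose–Einstein condensate
  and the Hubbard star*, Phys. Rev. B **96** (2017) 064502, Theorem 1 and Appendix A
  (eqs. (A3), (A4)) — the counting device used in the core estimate.
* R. A. Horn, C. R. Johnson, *Matrix Analysis*, 2nd ed. (2013), Corollary 4.4.19 (normal form of
  a skew-symmetric matrix under unitary congruence).
* O. Bratteli, D. W. Robinson, *Operator Algebras and Quantum Statistical Mechanics II*,
  2nd ed., Springer (1997), §5.2.2 (the CAR algebra, `a(f)`, `a*(f)`).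
-/

namespace Literature.MathematicalPhysics.QuantumLattice.RayleighBound

open Matrix Finset

variable {ι : Type*} [LinearOrder ι] [Fintype ι]

/-- Coordinates of `c_i c_j ψ`. [folklore] -/
theorem annihilation_mul_annihilation_mulVec_apply (i j : ι) (ψ : Fock ι) (s : Finset ι) :
    ((annihilation i * annihilation j) *ᵥ ψ) s =
      if i ∉ s ∧ j ∉ s ∧ i ≠ j then
        jwSign i s * jwSign j (insert i s) * ψ (insert j (insert i s)) else 0 := by
  rw [← mulVec_mulVec, annihilation_mulVec_apply]
  by_cases hi : i ∈ s
  · simp [hi]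
  · rw [if_pos hi, annihilation_mulVec_apply]
    by_cases hj : j ∈ s
    · simp [hj]
    · by_cases hij : i = j
      · subst hij; simp
      · rw [if_pos (by simp [hj, Ne.symm hij]), if_pos ⟨hi, hj, hij⟩, mul_assoc]

end Literature.MathematicalPhysics.QuantumLattice.RayleighBound

/-! ## Smeared operators -/

namespace Literature.MathematicalPhysics.QuantumLattice.RayleighBound

open Matrix Finset

variable {ι : Type*} [LinearOrder ι] [Fintype ι]

/-- The smeared annihilation operator `c(f) = Σ_i conj (f i) • c_i` (antilinear in `f`): for a unit
vector `f` it annihilates a fermion in the one-particle state `f`. Bratteli–Robinson II §5.2.2,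
`a(f)`. [cite: BratteliRobinsonII1997, §5.2.2] -/
def annihilate (f : ι → ℂ) : Matrix (Finset ι) (Finset ι) ℂ := ∑ i, star (f i) • annihilation i

/-- The smeared creation operator `c†(f) = c(f)ᴴ = Σ_i f i • c†_i` (linear in `f`).
Bratteli–Robinson II §5.2.2, `a*(f)`. [cite: BratteliRobinsonII1997, §5.2.2] -/
def create (f : ι → ℂ) : Matrix (Finset ι) (Finset ι) ℂ := ∑ i, f i • creation i

/-- `c(f)ᴴ = c†(f)`. [folklore] -/
theorem annihilate_conjTranspose (f : ι → ℂ) : (annihilate f)ᴴ = create f := by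
  simp [annihilate, create, conjTranspose_sum, conjTranspose_smul, creation]

/-- `c†(f)ᴴ = c(f)`. [folklore] -/
theorem create_conjTranspose (f : ι → ℂ) : (create f)ᴴ = annihilate f := by
  rw [← annihilate_conjTranspose, conjTranspose_conjTranspose]

/-- Expansion of a product of two smeared annihilation operators. [folklore] -/
theorem annihilate_mul_annihilate_eq_sum (f g : ι → ℂ) :
    annihilate f * annihilate g =
      ∑ i, ∑ j, (star (f i) * star (g j)) • (annihilation i * annihilation j) := by
  simp only [annihilate, Finset.sum_mul_sum, smul_mul_smul_comm]

/-- Pure CAR for smeared operators: `c(f) c(g) = - c(g) c(f)`. [folklore] -/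
theorem annihilate_mul_annihilate (f g : ι → ℂ) :
    annihilate f * annihilate g = -(annihilate g * annihilate f) := by
  have h := annihilation_anticommute_holds (ι := ι)
  rw [annihilate_mul_annihilate_eq_sum, annihilate_mul_annihilate_eq_sum, Finset.sum_comm,
    ← Finset.sum_neg_distrib]
  refine Finset.sum_congr rfl fun j _ => ?_
  rw [← Finset.sum_neg_distrib]
  refine Finset.sum_congr rfl fun i _ => ?_
  rw [eq_neg_iff_add_eq_zero.mpr (h j i), smul_neg, neg_neg, mul_comm]

/-- `c(f)² = 0`. [folklore] -/
theorem annihilate_mul_self (f : ι → ℂ) : annihilate f * annihilate f = 0 := by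
  have h := annihilate_mul_annihilate f f
  rw [eq_neg_iff_add_eq_zero, ← two_smul ℂ] at h
  exact (smul_eq_zero.mp h).resolve_left two_ne_zero

/-- Mixed CAR for smeared operators: `c(f) c†(g) + c†(g) c(f) = ⟨f, g⟩ · 1`. [folklore] -/
theorem annihilate_mul_create_add (f g : ι → ℂ) :
    annihilate f * create g + create g * annihilate f =
      (star f ⬝ᵥ g) • (1 : Matrix (Finset ι) (Finset ι) ℂ) := by
  have h := annihilation_mul_creation_add_creation_mul_annihilation_holds (ι := ι)
  have h1 : annihilate f * create g =
      ∑ i, ∑ j, (star (f i) * g j) • (annihilation i * creation j) := by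
    simp only [annihilate, create, Finset.sum_mul_sum, smul_mul_smul_comm]
  have h2 : create g * annihilate f =
      ∑ i, ∑ j, (star (f i) * g j) • (creation j * annihilation i) := by
    simp only [annihilate, create, Finset.sum_mul_sum, smul_mul_smul_comm]
    rw [Finset.sum_comm]
    simp_rw [mul_comm (g _) (star (f _))]
  rw [h1, h2, ← Finset.sum_add_distrib, dotProduct, Finset.sum_smul]
  refine Finset.sum_congr rfl fun i _ => ?_
  rw [← Finset.sum_add_distrib]
  calc ∑ j, ((star (f i) * g j) • (annihilation i * creation j) +
          (star (f i) * g j) • (creation j * annihilation i))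
      = ∑ j, (star (f i) * g j) • (if i = j then (1 : Matrix (Finset ι) (Finset ι) ℂ) else 0) :=
        Finset.sum_congr rfl fun j _ => by rw [← smul_add, h i j]
    _ = (star (f i) * g i) • (1 : Matrix (Finset ι) (Finset ι) ℂ) := by
        simp_rw [smul_ite, smul_zero, Finset.sum_ite_eq, Finset.mem_univ, if_true]

end Literature.MathematicalPhysics.QuantumLattice.RayleighBound

/-! ## Sectors, norms, rotated number operators -/

namespace Literature.MathematicalPhysics.QuantumLattice.RayleighBound

open Matrix Finset

variable {ι : Type*} [LinearOrder ι] [Fintype ι]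

/-- `⟨A x, y⟩ = ⟨x, Aᴴ y⟩` for the dot-product pairing `star · ⬝ᵥ ·`. [folklore] -/
theorem star_mulVec_dotProduct {m : Type*} [Fintype m] (A : Matrix m m ℂ) (x y : m → ℂ) :
    star (A *ᵥ x) ⬝ᵥ y = star x ⬝ᵥ (Aᴴ *ᵥ y) := by
  rw [star_mulVec, dotProduct_mulVec]

/-- The squared `ℓ²`-norm `Σ_s |φ s|²` of a Fock vector, as a real number. [folklore] -/
noncomputable def normSq (φ : Fock ι) : ℝ := ∑ s, ‖φ s‖ ^ 2

omit [LinearOrder ι] in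
/-- `star φ ⬝ᵥ φ = Σ_s |φ s|²`. [folklore] -/
theorem star_dotProduct_self_eq_normSq (φ : Fock ι) : star φ ⬝ᵥ φ = ((normSq φ : ℝ) : ℂ) := by
  simp only [dotProduct, normSq, Pi.star_apply, Complex.ofReal_sum, Complex.ofReal_pow]
  refine Finset.sum_congr rfl fun s _ => ?_
  rw [Complex.star_def, Complex.conj_mul']

omit [LinearOrder ι] in
/-- `normSq φ ≥ 0`. [folklore] -/
theorem normSq_nonneg (φ : Fock ι) : 0 ≤ normSq φ :=
  Finset.sum_nonneg fun s _ => by positivity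

/-- Coordinates of `c(f) ψ`. [folklore] -/
theorem annihilate_mulVec_apply (f : ι → ℂ) (ψ : Fock ι) (s : Finset ι) :
    (annihilate f *ᵥ ψ) s =
      ∑ i, star (f i) * (if i ∉ s then jwSign i s * ψ (insert i s) else 0) := by
  simp only [annihilate, Matrix.sum_mulVec, Matrix.smul_mulVec, Finset.sum_apply, Pi.smul_apply,
    smul_eq_mul, annihilation_mulVec_apply]

/-- Coordinates of `c†(f) ψ`. [folklore] -/
theorem create_mulVec_apply (f : ι → ℂ) (ψ : Fock ι) (s : Finset ι) :
    (create f *ᵥ ψ) s =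
      ∑ i, f i * (if i ∈ s then jwSign i s * ψ (s.erase i) else 0) := by
  simp only [create, Matrix.sum_mulVec, Matrix.smul_mulVec, Finset.sum_apply, Pi.smul_apply,
    smul_eq_mul, creation_mulVec_apply, jwSign_erase_self]

/-- `c(f)` lowers the particle number by one. [folklore] -/
theorem _root_.Literature.MathematicalPhysics.QuantumLattice.IsNParticle.annihilate_mulVec
    {n : ℕ} {ψ : Fock ι} (hψ : IsNParticle (n + 1) ψ)
    (f : ι → ℂ) : IsNParticle n (annihilate f *ᵥ ψ) := by
  intro s hs
  rw [annihilate_mulVec_apply]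
  refine Finset.sum_eq_zero fun i _ => ?_
  split_ifs with hi
  · rw [mul_zero]
  · rw [hψ (insert i s) (by rw [Finset.card_insert_of_notMem hi]; omega), mul_zero, mul_zero]

/-- `c(f)` kills the vacuum sector. [folklore] -/
theorem _root_.Literature.MathematicalPhysics.QuantumLattice.IsNParticle.annihilate_mulVec_zero
    {ψ : Fock ι} (hψ : IsNParticle 0 ψ) (f : ι → ℂ) :
    annihilate f *ᵥ ψ = 0 := by
  funext s
  rw [annihilate_mulVec_apply, Pi.zero_apply]
  refine Finset.sum_eq_zero fun i _ => ?_
  split_ifs with hi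
  · rw [mul_zero]
  · rw [hψ (insert i s) (by rw [Finset.card_insert_of_notMem hi]; omega), mul_zero, mul_zero]

/-- `c†(f)` raises the particle number by one. [folklore] -/
theorem _root_.Literature.MathematicalPhysics.QuantumLattice.IsNParticle.create_mulVec
    {n : ℕ} {ψ : Fock ι} (hψ : IsNParticle n ψ) (f : ι → ℂ) :
    IsNParticle (n + 1) (create f *ᵥ ψ) := by
  intro s hs
  rw [create_mulVec_apply]
  refine Finset.sum_eq_zero fun i _ => ?_
  split_ifs with hi
  · rw [hψ (s.erase i) (by rw [Finset.card_erase_of_mem hi]; have := Finset.card_pos.mpr ⟨i, hi⟩; omega),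
      mul_zero, mul_zero]
  · rw [mul_zero]

/-- `c†(f) ψ` has no vacuum component. [folklore] -/
theorem create_mulVec_empty (f : ι → ℂ) (ψ : Fock ι) : (create f *ᵥ ψ) ∅ = 0 := by
  rw [create_mulVec_apply]
  exact Finset.sum_eq_zero fun i _ => by simp

omit [LinearOrder ι] in
/-- A `0`-particle vector is its vacuum component times `|∅⟩`; in particular its norm is
`|φ ∅|²`. [folklore] -/
theorem _root_.Literature.MathematicalPhysics.QuantumLattice.IsNParticle.normSq_zero
    {φ : Fock ι} (hφ : IsNParticle 0 φ) : normSq φ = ‖φ ∅‖ ^ 2 := by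
  rw [normSq, Finset.sum_eq_single (∅ : Finset ι)]
  · intro s _ hs
    rw [hφ s (fun h => hs (Finset.card_eq_zero.mp h)), norm_zero, zero_pow two_ne_zero]
  · exact fun h => absurd (Finset.mem_univ _) h

/-- `⟨φ, N φ⟩ = n ‖φ‖²` on the `n`-particle sector. [folklore] -/
theorem _root_.Literature.MathematicalPhysics.QuantumLattice.IsNParticle.star_dotProduct_totalNumberOp_mulVec
    {n : ℕ} {φ : Fock ι} (hφ : IsNParticle n φ) :
    star φ ⬝ᵥ (Literature.MathematicalPhysics.QuantumLattice.totalNumberOp *ᵥ φ) = n * ((normSq φ : ℝ) : ℂ) := by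
  rw [Literature.MathematicalPhysics.QuantumLattice.totalNumberOp_eq_diagonal, ← star_dotProduct_self_eq_normSq,
    dotProduct, dotProduct, Finset.mul_sum]
  refine Finset.sum_congr rfl fun s _ => ?_
  rw [mulVec_diagonal]
  by_cases hs : s.card = n
  · rw [hs, Pi.star_apply]; ring
  · rw [hφ s hs]; simp

variable {κ : Type*} [Fintype κ]

/-- Completeness `Σ_k u_k(i) conj(u_k(j)) = δ_ij` of a family `u : κ → ℂ^ι` makes the rotated
number operators `c†(u_k) c(u_k)` sum to the total number operator. [folklore] -/
theorem sum_create_mul_annihilate (u : κ → ι → ℂ)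
    (hu : ∀ i j : ι, ∑ k, u k i * star (u k j) = if i = j then 1 else 0) :
    ∑ k, create (u k) * annihilate (u k) = Literature.MathematicalPhysics.QuantumLattice.totalNumberOp := by
  have h1 : ∀ k, create (u k) * annihilate (u k) =
      ∑ i, ∑ j, (u k i * star (u k j)) • (creation i * annihilation j) := fun k => by
    simp only [annihilate, create, Finset.sum_mul_sum, smul_mul_smul_comm]
  simp_rw [h1]
  rw [Finset.sum_comm]
  simp_rw [Finset.sum_comm (s := (univ : Finset κ)), ← Finset.sum_smul, hu, ite_smul, zero_smul,
    one_smul, Finset.sum_ite_eq, Finset.mem_univ, if_true]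
  rfl

/-- `Σ_k ‖c(u_k) φ‖² = n ‖φ‖²` for an `n`-particle `φ` and a complete family `u`. [folklore] -/
theorem _root_.Literature.MathematicalPhysics.QuantumLattice.IsNParticle.sum_normSq_annihilate_mulVec (u : κ → ι → ℂ)
    (hu : ∀ i j : ι, ∑ k, u k i * star (u k j) = if i = j then 1 else 0)
    {n : ℕ} {φ : Fock ι} (hφ : IsNParticle n φ) :
    ∑ k, normSq (annihilate (u k) *ᵥ φ) = n * normSq φ := by
  have h : ∀ k, ((normSq (annihilate (u k) *ᵥ φ) : ℝ) : ℂ) =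
      star φ ⬝ᵥ ((create (u k) * annihilate (u k)) *ᵥ φ) := fun k => by
    rw [← star_dotProduct_self_eq_normSq, star_mulVec_dotProduct, annihilate_conjTranspose,
      mulVec_mulVec]
  apply Complex.ofReal_injective
  rw [Complex.ofReal_sum, Complex.ofReal_mul, Complex.ofReal_natCast]
  simp_rw [h]
  rw [← dotProduct_sum, ← Matrix.sum_mulVec, sum_create_mul_annihilate u hu,
    hφ.star_dotProduct_totalNumberOp_mulVec]

end Literature.MathematicalPhysics.QuantumLattice.RayleighBound

/-! ## Rotated number operators for an orthonormal family -/

namespace Literature.MathematicalPhysics.QuantumLattice.RayleighBound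

open Matrix Finset

variable {ι : Type*} [LinearOrder ι] [Fintype ι]

/-- `c(f) c†(g) = -c†(g) c(f)` for orthogonal `f ⊥ g`. [folklore] -/
theorem annihilate_mul_create_of_orthogonal {f g : ι → ℂ} (h : star f ⬝ᵥ g = 0) :
    annihilate f * create g = -(create g * annihilate f) := by
  rw [eq_neg_iff_add_eq_zero, annihilate_mul_create_add, h, zero_smul]

/-- `c(f) c†(f) = 1 - c†(f) c(f)` for a unit vector `f`. [folklore] -/
theorem annihilate_mul_create_of_unit {f : ι → ℂ} (h : star f ⬝ᵥ f = 1) :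
    annihilate f * create f = 1 - create f * annihilate f := by
  rw [eq_sub_iff_add_eq, annihilate_mul_create_add, h, one_smul]

/-- `c†(f) c†(g) = - c†(g) c†(f)`. [folklore] -/
theorem create_mul_create (f g : ι → ℂ) : create f * create g = -(create g * create f) := by
  rw [← annihilate_conjTranspose, ← annihilate_conjTranspose, ← conjTranspose_mul,
    annihilate_mul_annihilate g f, conjTranspose_neg, conjTranspose_mul]

/-- The number operator `n(f) = c†(f) c(f)` of the mode `f`. Bratteli–Robinson II §5.2.2.
[cite: BratteliRobinsonII1997, §5.2.2] -/
def numberMode (f : ι → ℂ) : Matrix (Finset ι) (Finset ι) ℂ := create f * annihilate f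

/-- `n(f)` is self-adjoint. [folklore] -/
theorem numberMode_conjTranspose (f : ι → ℂ) : (numberMode f)ᴴ = numberMode f := by
  rw [numberMode, conjTranspose_mul, annihilate_conjTranspose, create_conjTranspose]

/-- `c(f) n(f) = c(f)` for a unit vector `f`. [folklore] -/
theorem annihilate_mul_numberMode_self {f : ι → ℂ} (h : star f ⬝ᵥ f = 1) :
    annihilate f * numberMode f = annihilate f := by
  rw [numberMode, ← mul_assoc, annihilate_mul_create_of_unit h, sub_mul, one_mul, mul_assoc,
    annihilate_mul_self, mul_zero, sub_zero]

/-- `n(f)² = n(f)` for a unit vector `f`. [folklore] -/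
theorem numberMode_mul_self {f : ι → ℂ} (h : star f ⬝ᵥ f = 1) :
    numberMode f * numberMode f = numberMode f := by
  conv_lhs => rw [numberMode, mul_assoc, ← numberMode, annihilate_mul_numberMode_self h]
  rfl

/-- `c(f) (1 - n(f)) = 0` for a unit vector `f`. [folklore] -/
theorem annihilate_mul_one_sub_numberMode_self {f : ι → ℂ} (h : star f ⬝ᵥ f = 1) :
    annihilate f * (1 - numberMode f) = 0 := by
  rw [mul_sub, mul_one, annihilate_mul_numberMode_self h, sub_self]

/-- `c(f)` commutes with `n(g)` for `f ⊥ g`. [folklore] -/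
theorem annihilate_mul_numberMode_of_orthogonal {f g : ι → ℂ} (h : star f ⬝ᵥ g = 0) :
    annihilate f * numberMode g = numberMode g * annihilate f := by
  rw [numberMode, ← mul_assoc, annihilate_mul_create_of_orthogonal h, neg_mul, mul_assoc,
    annihilate_mul_annihilate f g, mul_neg, neg_neg, mul_assoc]

/-- `c†(f)` commutes with `n(g)` for `g ⊥ f`. [folklore] -/
theorem create_mul_numberMode_of_orthogonal {f g : ι → ℂ} (h : star f ⬝ᵥ g = 0) :
    create f * numberMode g = numberMode g * create f := by
  have h' := congr_arg conjTranspose (annihilate_mul_numberMode_of_orthogonal h)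
  simp only [conjTranspose_mul, numberMode_conjTranspose, annihilate_conjTranspose] at h'
  exact h'.symm

/-- Number operators of orthogonal modes commute. [folklore] -/
theorem numberMode_mul_numberMode_of_orthogonal {f g : ι → ℂ} (h : star f ⬝ᵥ g = 0) :
    numberMode f * numberMode g = numberMode g * numberMode f := by
  conv_lhs => rw [numberMode, mul_assoc, annihilate_mul_numberMode_of_orthogonal h, ← mul_assoc,
    create_mul_numberMode_of_orthogonal h, mul_assoc, ← numberMode]

/-- `(c(g) c(f))ᴴ (c(g) c(f)) = n(f) n(g)` for orthogonal `f ⊥ g`. [folklore] -/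
theorem pair_conjTranspose_mul_pair {f g : ι → ℂ} (hfg : star f ⬝ᵥ g = 0) :
    (annihilate g * annihilate f)ᴴ * (annihilate g * annihilate f) =
      numberMode f * numberMode g := by
  rw [conjTranspose_mul, annihilate_conjTranspose, annihilate_conjTranspose, mul_assoc,
    ← mul_assoc (create g), ← numberMode, ← mul_assoc, create_mul_numberMode_of_orthogonal hfg,
    mul_assoc, ← numberMode, numberMode_mul_numberMode_of_orthogonal hfg]

/-- `n(f)` preserves each particle-number sector. [folklore] -/
theorem _root_.Literature.MathematicalPhysics.QuantumLattice.IsNParticle.numberMode_mulVec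
    {n : ℕ} {ψ : Fock ι} (hψ : IsNParticle n ψ) (f : ι → ℂ) :
    IsNParticle n (numberMode f *ᵥ ψ) := by
  rw [numberMode, ← mulVec_mulVec]
  cases n with
  | zero => rw [hψ.annihilate_mulVec_zero, mulVec_zero]; exact fun _ _ => rfl
  | succ m => exact (hψ.annihilate_mulVec f).create_mulVec f

/-- `1 - n(f)` preserves each particle-number sector. [folklore] -/
theorem _root_.Literature.MathematicalPhysics.QuantumLattice.IsNParticle.one_sub_numberMode_mulVec
    {n : ℕ} {ψ : Fock ι} (hψ : IsNParticle n ψ)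
    (f : ι → ℂ) : IsNParticle n ((1 - numberMode f) *ᵥ ψ) := by
  rw [sub_mulVec, one_mulVec]
  intro s hs
  rw [Pi.sub_apply, hψ s hs, hψ.numberMode_mulVec f s hs, sub_zero]

/-- `n(f) ψ` has no vacuum component. [folklore] -/
theorem numberMode_mulVec_empty (f : ι → ℂ) (ψ : Fock ι) : (numberMode f *ᵥ ψ) ∅ = 0 := by
  rw [numberMode, ← mulVec_mulVec, create_mulVec_empty]

end Literature.MathematicalPhysics.QuantumLattice.RayleighBound

/-! ## Amplitudes in a rotated one-particle basis -/

namespace Literature.MathematicalPhysics.QuantumLattice.RayleighBound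

open Matrix Finset

variable {ι : Type*} [LinearOrder ι] [Fintype ι] {κ : Type*}

/-- The amplitude `⟨∅| c(u_{j(n-1)}) ⋯ c(u_{j 0}) |φ⟩` of a Fock vector `φ` on the ordered tuple of
modes `j : Fin n → κ` of a family `u : κ → ℂ^ι` (for an orthonormal basis `u` and an
`n`-particle `φ` these are `√n!` times the coefficients of `φ` in the Slater-determinant basis
built from `u`). Defined recursively: annihilate the first mode, then the rest.
Bratteli–Robinson II §5.2.2. [folklore] -/
def amp (u : κ → ι → ℂ) : (n : ℕ) → Fock ι → (Fin n → κ) → ℂ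
  | 0, φ, _ => φ ∅
  | n + 1, φ, j => amp u n (annihilate (u (j 0)) *ᵥ φ) (Fin.tail j)

variable (u : κ → ι → ℂ)

/-- Unfolding `amp` at `n = 0`. [folklore] -/
@[simp] theorem amp_zero (φ : Fock ι) (j : Fin 0 → κ) : amp u 0 φ j = φ ∅ := rfl

/-- Unfolding `amp` at `n + 1`. [folklore] -/
theorem amp_succ (n : ℕ) (φ : Fock ι) (j : Fin (n + 1) → κ) :
    amp u (n + 1) φ j = amp u n (annihilate (u (j 0)) *ᵥ φ) (Fin.tail j) := rfl

/-- `amp` on a tuple `k :: j`. [folklore] -/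
theorem amp_cons (n : ℕ) (φ : Fock ι) (k : κ) (j : Fin n → κ) :
    amp u (n + 1) φ (Fin.cons k j) = amp u n (annihilate (u k) *ᵥ φ) j := by
  rw [amp_succ, Fin.cons_zero, Fin.tail_cons]

/-- `amp u n · j` is linear: additivity. [folklore] -/
theorem amp_add (n : ℕ) (φ ψ : Fock ι) (j : Fin n → κ) :
    amp u n (φ + ψ) j = amp u n φ j + amp u n ψ j := by
  induction n generalizing φ ψ with
  | zero => rfl
  | succ n ih => rw [amp_succ, amp_succ, amp_succ, mulVec_add, ih]

/-- `amp u n · j` is linear: homogeneity. [folklore] -/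
theorem amp_smul (n : ℕ) (a : ℂ) (φ : Fock ι) (j : Fin n → κ) :
    amp u n (a • φ) j = a * amp u n φ j := by
  induction n generalizing φ with
  | zero => rfl
  | succ n ih => rw [amp_succ, amp_succ, mulVec_smul, ih]

/-- `amp u n · j` as a linear functional. [folklore] -/
def ampLinear (n : ℕ) (j : Fin n → κ) : Fock ι →ₗ[ℂ] ℂ where
  toFun φ := amp u n φ j
  map_add' φ ψ := amp_add u n φ ψ j
  map_smul' a φ := amp_smul u n a φ j

/-- `ampLinear` evaluates to `amp`. [folklore] -/
@[simp] theorem ampLinear_apply (n : ℕ) (j : Fin n → κ) (φ : Fock ι) :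
    ampLinear u n j φ = amp u n φ j := rfl

/-- `amp` of the zero vector vanishes. [folklore] -/
theorem amp_zero_vec (n : ℕ) (j : Fin n → κ) : amp u n 0 j = 0 :=
  (ampLinear u n j).map_zero

/-- `amp` of a negation. [folklore] -/
theorem amp_neg (n : ℕ) (φ : Fock ι) (j : Fin n → κ) : amp u n (-φ) j = -amp u n φ j :=
  (ampLinear u n j).map_neg φ

/-- `amp` of a difference. [folklore] -/
theorem amp_sub (n : ℕ) (φ ψ : Fock ι) (j : Fin n → κ) :
    amp u n (φ - ψ) j = amp u n φ j - amp u n ψ j :=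
  (ampLinear u n j).map_sub φ ψ

/-- `amp` of a finite sum. [folklore] -/
theorem amp_sum {L : Type*} (s : Finset L) (n : ℕ) (φ : L → Fock ι) (j : Fin n → κ) :
    amp u n (∑ a ∈ s, φ a) j = ∑ a ∈ s, amp u n (φ a) j :=
  map_sum (ampLinear u n j) φ s

/-- Pauli principle for amplitudes, first form: annihilating a mode that is annihilated again
later gives zero. [folklore] -/
theorem amp_annihilate_eq_zero (n : ℕ) (φ : Fock ι) (r : Fin n → κ) (k : κ)
    (hk : ∃ t, r t = k) : amp u n (annihilate (u k) *ᵥ φ) r = 0 := by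
  induction n generalizing φ with
  | zero => exact absurd hk (fun ⟨t, _⟩ => Fin.elim0 t)
  | succ n ih =>
    rw [amp_succ, mulVec_mulVec]
    by_cases h0 : r 0 = k
    · rw [h0, annihilate_mul_self, zero_mulVec, amp_zero_vec]
    · obtain ⟨t, ht⟩ := hk
      have ht0 : t ≠ 0 := fun h => h0 (h ▸ ht)
      rw [annihilate_mul_annihilate, neg_mulVec, amp_neg, ← mulVec_mulVec,
        ih _ _ ⟨t.pred ht0, by simp only [Fin.tail, Fin.succ_pred]; exact ht⟩, neg_zero]

/-- Pauli principle for amplitudes: `amp u n φ j = 0` unless `j` is injective. [folklore] -/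
theorem amp_eq_zero_of_not_injective (n : ℕ) (φ : Fock ι) (j : Fin n → κ)
    (hj : ¬ Function.Injective j) : amp u n φ j = 0 := by
  induction n generalizing φ with
  | zero => exact absurd (Function.injective_of_subsingleton j) hj
  | succ n ih =>
    rw [amp_succ]
    simp only [Function.Injective, not_forall] at hj
    obtain ⟨p, q, hpq, hne⟩ := hj
    -- order the two positions
    wlog hlt : p < q generalizing p q
    · exact this q p hpq.symm (Ne.symm hne) (lt_of_le_of_ne (not_lt.mp hlt) (Ne.symm hne))
    have hq0 : q ≠ 0 := fun h => (Fin.not_lt_zero p) (h ▸ hlt)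
    by_cases hp0 : p = 0
    · subst hp0
      exact amp_annihilate_eq_zero u n _ _ _ ⟨q.pred hq0, by
        simp only [Fin.tail, Fin.succ_pred]; exact hpq.symm⟩
    · refine ih _ _ fun hinj => ?_
      have := @hinj (p.pred hp0) (q.pred hq0) (by
        simp only [Fin.tail, Fin.succ_pred]; exact hpq)
      exact hne (by rwa [Fin.pred_inj] at this)

end Literature.MathematicalPhysics.QuantumLattice.RayleighBound

namespace Literature.MathematicalPhysics.QuantumLattice.RayleighBound

open Matrix Finset

variable {ι : Type*} [LinearOrder ι] [Fintype ι] {κ : Type*} [DecidableEq κ] (u : κ → ι → ℂ)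

/-- `c(u_l)` commutes with `1 - n(u_k)` for `l ≠ k` (orthonormal `u`). [folklore] -/
theorem annihilate_mul_one_sub_numberMode_comm
    (hu : ∀ k l, star (u k) ⬝ᵥ u l = if k = l then 1 else 0) {k l : κ} (hkl : l ≠ k) :
    annihilate (u l) * (1 - numberMode (u k)) = (1 - numberMode (u k)) * annihilate (u l) := by
  have h0 : star (u l) ⬝ᵥ u k = 0 := by rw [hu, if_neg hkl]
  rw [mul_sub, sub_mul, mul_one, one_mul, annihilate_mul_numberMode_of_orthogonal h0]

/-- Inserting the projection `1 - n(u_k)` ("mode `k` empty"): the amplitude is unchanged on tuples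
avoiding `k` (orthonormal `u`). [folklore] -/
theorem amp_one_sub_numberMode_of_forall_ne
    (hu : ∀ k l, star (u k) ⬝ᵥ u l = if k = l then 1 else 0)
    (n : ℕ) (φ : Fock ι) (j : Fin n → κ) (k : κ) (hk : ∀ t, j t ≠ k) :
    amp u n ((1 - numberMode (u k)) *ᵥ φ) j = amp u n φ j := by
  induction n generalizing φ with
  | zero =>
    rw [amp_zero, amp_zero, sub_mulVec, one_mulVec, Pi.sub_apply, numberMode_mulVec_empty, sub_zero]
  | succ n ih =>
    rw [amp_succ, amp_succ, mulVec_mulVec, annihilate_mul_one_sub_numberMode_comm u hu (hk 0),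
      ← mulVec_mulVec]
    exact ih _ _ (fun t => hk t.succ)

/-- Inserting the projection `1 - n(u_k)`: the amplitude vanishes on tuples containing `k`
(orthonormal `u`). [folklore] -/
theorem amp_one_sub_numberMode_of_exists
    (hu : ∀ k l, star (u k) ⬝ᵥ u l = if k = l then 1 else 0)
    (n : ℕ) (φ : Fock ι) (j : Fin n → κ) (k : κ) (hk : ∃ t, j t = k) :
    amp u n ((1 - numberMode (u k)) *ᵥ φ) j = 0 := by
  induction n generalizing φ with
  | zero => exact absurd hk (fun ⟨t, _⟩ => Fin.elim0 t)
  | succ n ih =>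
    rw [amp_succ, mulVec_mulVec]
    by_cases h0 : j 0 = k
    · rw [h0, annihilate_mul_one_sub_numberMode_self (by rw [hu, if_pos rfl]), zero_mulVec,
        amp_zero_vec]
    · obtain ⟨t, ht⟩ := hk
      have ht0 : t ≠ 0 := fun h => h0 (h ▸ ht)
      rw [annihilate_mul_one_sub_numberMode_comm u hu h0, ← mulVec_mulVec]
      exact ih _ _ ⟨t.pred ht0, by simp only [Fin.tail, Fin.succ_pred]; exact ht⟩

/-- Inserting `n(u_k)` ("mode `k` occupied"): unchanged on tuples containing `k`. [folklore] -/
theorem amp_numberMode_of_exists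
    (hu : ∀ k l, star (u k) ⬝ᵥ u l = if k = l then 1 else 0)
    (n : ℕ) (φ : Fock ι) (j : Fin n → κ) (k : κ) (hk : ∃ t, j t = k) :
    amp u n (numberMode (u k) *ᵥ φ) j = amp u n φ j := by
  have h := amp_one_sub_numberMode_of_exists u hu n φ j k hk
  rwa [sub_mulVec, one_mulVec, amp_sub, sub_eq_zero, eq_comm] at h

/-- Inserting `n(u_k)`: vanishes on tuples avoiding `k`. [folklore] -/
theorem amp_numberMode_of_forall_ne
    (hu : ∀ k l, star (u k) ⬝ᵥ u l = if k = l then 1 else 0)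
    (n : ℕ) (φ : Fock ι) (j : Fin n → κ) (k : κ) (hk : ∀ t, j t ≠ k) :
    amp u n (numberMode (u k) *ᵥ φ) j = 0 := by
  have h := amp_one_sub_numberMode_of_forall_ne u hu n φ j k hk
  rwa [sub_mulVec, one_mulVec, amp_sub, sub_eq_self] at h

variable [Fintype κ]

omit [DecidableEq κ] in
/-- **Norm identity.** For a complete family `u` and an `n`-particle `φ`,
`Σ_j |amp u n φ j|² = n! ‖φ‖²` (the amplitudes are `√n!` times orthonormal-basis coefficients).
[folklore] -/
theorem sum_norm_amp_sq (hu' : ∀ i j : ι, ∑ k, u k i * star (u k j) = if i = j then 1 else 0)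
    (n : ℕ) (φ : Fock ι) (hφ : IsNParticle n φ) :
    ∑ j : Fin n → κ, ‖amp u n φ j‖ ^ 2 = n.factorial * normSq φ := by
  induction n generalizing φ with
  | zero =>
    rw [Fintype.sum_unique, amp_zero, hφ.normSq_zero, Nat.factorial_zero, Nat.cast_one, one_mul]
  | succ n ih =>
    rw [← (Fin.consEquiv fun _ => κ).sum_comp, Fintype.sum_prod_type]
    simp only [Fin.consEquiv, Equiv.coe_fn_mk, amp_cons]
    rw [Finset.sum_congr rfl fun k _ => ih _ (hφ.annihilate_mulVec (u k)), ← Finset.mul_sum,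
      hφ.sum_normSq_annihilate_mulVec u hu', Nat.factorial_succ, Nat.cast_mul, Nat.cast_succ]
    ring

end Literature.MathematicalPhysics.QuantumLattice.RayleighBound

/-! ## Conversion identities and counting lemmas for the core estimate -/

namespace Literature.MathematicalPhysics.QuantumLattice.RayleighBound

open Matrix Finset

variable {ι : Type*} [LinearOrder ι] [Fintype ι] {κ : Type*} [DecidableEq κ] (u : κ → ι → ℂ)

/-- `‖c(u_G) c(u_F) φ‖² = ‖n(u_F) n(u_G) φ‖²` for orthonormal modes `F ≠ G`: both equal
`⟨φ, n(u_F) n(u_G) φ⟩`. [folklore] -/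
theorem normSq_pair_mulVec (hu : ∀ k l, star (u k) ⬝ᵥ u l = if k = l then 1 else 0)
    {F G : κ} (hFG : F ≠ G) (φ : Fock ι) :
    normSq ((annihilate (u G) * annihilate (u F)) *ᵥ φ) =
      normSq (numberMode (u F) *ᵥ (numberMode (u G) *ᵥ φ)) := by
  have hfg : star (u F) ⬝ᵥ u G = 0 := by rw [hu, if_neg hFG]
  have hF : star (u F) ⬝ᵥ u F = 1 := by rw [hu, if_pos rfl]
  have hG : star (u G) ⬝ᵥ u G = 1 := by rw [hu, if_pos rfl]
  apply Complex.ofReal_injective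
  rw [← star_dotProduct_self_eq_normSq, ← star_dotProduct_self_eq_normSq, star_mulVec_dotProduct,
    mulVec_mulVec, pair_conjTranspose_mul_pair hfg, mulVec_mulVec, star_mulVec_dotProduct,
    mulVec_mulVec, conjTranspose_mul, numberMode_conjTranspose, numberMode_conjTranspose,
    mul_assoc, ← mul_assoc (numberMode (u F)) (numberMode (u F)), numberMode_mul_self hF,
    numberMode_mul_numberMode_of_orthogonal hfg, ← mul_assoc, numberMode_mul_self hG,
    ← numberMode_mul_numberMode_of_orthogonal hfg]

variable [Fintype κ]

/-- Conversion identity: `Σ_j [F, G ∈ j] |amp φ j|² = (m+2)! ‖n(u_F) n(u_G) φ‖²…` in the form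
`Σ_j |amp (n_F n_G φ) j|²` with the indicator made explicit. [folklore] -/
theorem sum_norm_amp_numberMode_numberMode_sq
    (hu : ∀ k l, star (u k) ⬝ᵥ u l = if k = l then 1 else 0)
    (n : ℕ) (φ : Fock ι) (F G : κ) :
    ∑ j : Fin n → κ, ‖amp u n (numberMode (u F) *ᵥ (numberMode (u G) *ᵥ φ)) j‖ ^ 2 =
      ∑ j ∈ (univ : Finset (Fin n → κ)).filter (fun j => (∃ t, j t = F) ∧ (∃ t, j t = G)),
        ‖amp u n φ j‖ ^ 2 := by
  classical
  rw [Finset.sum_filter]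
  refine Finset.sum_congr rfl fun j _ => ?_
  by_cases hF : ∃ t, j t = F
  · rw [amp_numberMode_of_exists u hu n _ j F hF]
    by_cases hG : ∃ t, j t = G
    · rw [amp_numberMode_of_exists u hu n _ j G hG, if_pos ⟨hF, hG⟩]
    · rw [amp_numberMode_of_forall_ne u hu n _ j G (fun t h => hG ⟨t, h⟩), if_neg (fun h => hG h.2),
        norm_zero, zero_pow two_ne_zero]
  · rw [amp_numberMode_of_forall_ne u hu n _ j F (fun t h => hF ⟨t, h⟩), if_neg (fun h => hF h.1),
      norm_zero, zero_pow two_ne_zero]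

omit [Fintype κ] in
/-- The "empty pair" projection `(1 - n(u_F))(1 - n(u_G))` inserted into an amplitude is the
indicator that the tuple avoids `F` and `G`. [folklore] -/
theorem norm_amp_emptyProj_sq (hu : ∀ k l, star (u k) ⬝ᵥ u l = if k = l then 1 else 0)
    (n : ℕ) (φ : Fock ι) (F G : κ) (j : Fin n → κ) :
    ‖amp u n ((1 - numberMode (u F)) *ᵥ ((1 - numberMode (u G)) *ᵥ φ)) j‖ ^ 2 =
      if (∀ t, j t ≠ F) ∧ (∀ t, j t ≠ G) then ‖amp u n φ j‖ ^ 2 else 0 := by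
  classical
  by_cases hF : ∀ t, j t ≠ F
  · rw [amp_one_sub_numberMode_of_forall_ne u hu n _ j F hF]
    by_cases hG : ∀ t, j t ≠ G
    · rw [amp_one_sub_numberMode_of_forall_ne u hu n _ j G hG, if_pos ⟨hF, hG⟩]
    · rw [amp_one_sub_numberMode_of_exists u hu n _ j G (by simpa using hG), if_neg (fun h => hG h.2),
        norm_zero, zero_pow two_ne_zero]
  · rw [amp_one_sub_numberMode_of_exists u hu n _ j F (by simpa using hF), if_neg (fun h => hF h.1),
      norm_zero, zero_pow two_ne_zero]

omit [DecidableEq κ] [Fintype κ] in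
/-- Counting lemma: the number of complete pairs `{F a, G a} ⊆ range j` is at most `n / 2`.
[folklore] -/
theorem two_mul_card_fullPairs_le {L : Type*} [Fintype L] [DecidableEq κ] (F G : L → κ)
    (hF : Function.Injective F) (hG : Function.Injective G) (hFG : ∀ a b, F a ≠ G b)
    {n : ℕ} (j : Fin n → κ) (S : Finset L)
    (hS : ∀ a ∈ S, (∃ t, j t = F a) ∧ (∃ t, j t = G a)) : 2 * S.card ≤ n := by
  classical
  have h1 : (S.image F).card = S.card := Finset.card_image_of_injective S hF
  have h2 : (S.image G).card = S.card := Finset.card_image_of_injective S hG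
  have hdisj : Disjoint (S.image F) (S.image G) := by
    rw [Finset.disjoint_left]
    rintro x hx hx'
    obtain ⟨a, _, rfl⟩ := Finset.mem_image.mp hx
    obtain ⟨b, _, hb⟩ := Finset.mem_image.mp hx'
    exact hFG a b hb.symm
  have hsub : S.image F ∪ S.image G ⊆ univ.image j := by
    intro x hx
    rcases Finset.mem_union.mp hx with hx | hx
    · obtain ⟨a, ha, rfl⟩ := Finset.mem_image.mp hx
      obtain ⟨t, ht⟩ := (hS a ha).1
      exact Finset.mem_image.mpr ⟨t, Finset.mem_univ _, ht⟩
    · obtain ⟨a, ha, rfl⟩ := Finset.mem_image.mp hx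
      obtain ⟨t, ht⟩ := (hS a ha).2
      exact Finset.mem_image.mpr ⟨t, Finset.mem_univ _, ht⟩
  calc 2 * S.card = (S.image F ∪ S.image G).card := by
        rw [Finset.card_union_of_disjoint hdisj, h1, h2, two_mul]
    _ ≤ (univ.image j).card := Finset.card_le_card hsub
    _ ≤ (univ : Finset (Fin n)).card := Finset.card_image_le
    _ = n := by rw [Finset.card_univ, Fintype.card_fin]

omit [DecidableEq κ] in
/-- Counting lemma: if `j : Fin n → κ` is injective, the number of pairs `{F b, G b}` disjoint from
`range j` is at most `(|κ| - n) / 2`. [folklore] -/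
theorem two_mul_card_emptyPairs_add_le {L : Type*} [Fintype L] [DecidableEq κ] (F G : L → κ)
    (hF : Function.Injective F) (hG : Function.Injective G) (hFG : ∀ a b, F a ≠ G b)
    {n : ℕ} (j : Fin n → κ) (hj : Function.Injective j) (S : Finset L)
    (hS : ∀ b ∈ S, (∀ t, j t ≠ F b) ∧ (∀ t, j t ≠ G b)) : 2 * S.card + n ≤ Fintype.card κ := by
  classical
  have h1 : (S.image F).card = S.card := Finset.card_image_of_injective S hF
  have h2 : (S.image G).card = S.card := Finset.card_image_of_injective S hG
  have h3 : (univ.image j).card = n := by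
    rw [Finset.card_image_of_injective _ hj, Finset.card_univ, Fintype.card_fin]
  have hdisj : Disjoint (S.image F) (S.image G) := by
    rw [Finset.disjoint_left]
    rintro x hx hx'
    obtain ⟨a, _, rfl⟩ := Finset.mem_image.mp hx
    obtain ⟨b, _, hb⟩ := Finset.mem_image.mp hx'
    exact hFG a b hb.symm
  have hdisj' : Disjoint (S.image F ∪ S.image G) (univ.image j) := by
    rw [Finset.disjoint_left]
    rintro x hx hx'
    obtain ⟨t, _, rfl⟩ := Finset.mem_image.mp hx'
    rcases Finset.mem_union.mp hx with hx | hx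
    · obtain ⟨a, ha, ha'⟩ := Finset.mem_image.mp hx
      exact (hS a ha).1 t ha'.symm
    · obtain ⟨a, ha, ha'⟩ := Finset.mem_image.mp hx
      exact (hS a ha).2 t ha'.symm
  calc 2 * S.card + n = ((S.image F ∪ S.image G) ∪ univ.image j).card := by
        rw [Finset.card_union_of_disjoint hdisj', Finset.card_union_of_disjoint hdisj, h1, h2, h3,
          two_mul]
    _ ≤ (univ : Finset κ).card := Finset.card_le_card (Finset.subset_univ _)
    _ = Fintype.card κ := Finset.card_univ

end Literature.MathematicalPhysics.QuantumLattice.RayleighBound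

/-! ## The core estimate -/

namespace Literature.MathematicalPhysics.QuantumLattice.RayleighBound

open Matrix Finset

/-- Two Cauchy–Schwarz estimates for `|Σ_a μ_a A_a|²` when `A` is supported on `E`, mixed with
weight `θ ∈ [0, 1]`: the device of Tennie–Vedral–Schilling, Phys. Rev. B 96 (2017) 064502,
Appendix A, eqs. (A3)–(A4). [cite: TennieVedralSchilling2017, Appendix A] -/
theorem norm_sum_mul_sq_le_convex {L : Type*} [Fintype L] (E : Finset L) (μ A : L → ℂ)
    (hA : ∀ a ∉ E, A a = 0) {θ : ℝ} (h0 : 0 ≤ θ) (h1 : θ ≤ 1) :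
    ‖∑ a, μ a * A a‖ ^ 2 ≤
      θ * ((∑ b ∈ E, ‖μ b‖ ^ 2) * ∑ a, ‖A a‖ ^ 2) +
        (1 - θ) * (E.card * ∑ a, ‖μ a‖ ^ 2 * ‖A a‖ ^ 2) := by
  have hsum : ∑ a, μ a * A a = ∑ a ∈ E, μ a * A a := by
    rw [← Finset.sum_subset (Finset.subset_univ E)]
    intro a _ ha
    rw [hA a ha, mul_zero]
  set s := ∑ a ∈ E, ‖μ a‖ * ‖A a‖ with hs
  have hle : ‖∑ a, μ a * A a‖ ≤ s := by
    rw [hsum]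
    exact (norm_sum_le _ _).trans (le_of_eq (Finset.sum_congr rfl fun a _ => norm_mul _ _))
  have cs1 : s ^ 2 ≤ (∑ b ∈ E, ‖μ b‖ ^ 2) * ∑ a, ‖A a‖ ^ 2 :=
    calc s ^ 2 ≤ (∑ a ∈ E, ‖μ a‖ ^ 2) * ∑ a ∈ E, ‖A a‖ ^ 2 := Finset.sum_mul_sq_le_sq_mul_sq E _ _
      _ ≤ _ := mul_le_mul_of_nonneg_left
          (Finset.sum_le_univ_sum_of_nonneg fun a => by positivity)
          (Finset.sum_nonneg fun _ _ => by positivity)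
  have cs2 : s ^ 2 ≤ E.card * ∑ a, ‖μ a‖ ^ 2 * ‖A a‖ ^ 2 := by
    have : s = ∑ a ∈ E, 1 * (‖μ a‖ * ‖A a‖) := by simp [hs]
    calc s ^ 2 ≤ (∑ a ∈ E, (1:ℝ) ^ 2) * ∑ a ∈ E, (‖μ a‖ * ‖A a‖) ^ 2 := by
          rw [this]; exact Finset.sum_mul_sq_le_sq_mul_sq E _ _
      _ ≤ E.card * ∑ a, ‖μ a‖ ^ 2 * ‖A a‖ ^ 2 := by
          rw [one_pow, Finset.sum_const, nsmul_eq_mul, mul_one]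
          simp_rw [mul_pow]
          exact mul_le_mul_of_nonneg_left
            (Finset.sum_le_univ_sum_of_nonneg fun a => by positivity) (Nat.cast_nonneg _)
  calc ‖∑ a, μ a * A a‖ ^ 2 ≤ s ^ 2 := pow_le_pow_left₀ (norm_nonneg _) hle 2
    _ = θ * s ^ 2 + (1 - θ) * s ^ 2 := by ring
    _ ≤ _ := add_le_add (mul_le_mul_of_nonneg_left cs1 h0)
        (mul_le_mul_of_nonneg_left cs2 (sub_nonneg.mpr h1))

variable {ι : Type*} [LinearOrder ι] [Fintype ι] {κ : Type*} [DecidableEq κ] [Fintype κ]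
  (u : κ → ι → ℂ) {L : Type*} [Fintype L] (F G : L → κ)

omit [DecidableEq κ] [Fintype κ] in
/-- Amplitudes of `(Σ_a μ_a c(u_{G a}) c(u_{F a})) ψ` in terms of amplitudes of `ψ`.
[folklore] -/
theorem amp_pairSum_mulVec (μ : L → ℂ) (m : ℕ) (ψ : Fock ι) (r : Fin m → κ) :
    amp u m ((∑ a, μ a • (annihilate (u (G a)) * annihilate (u (F a)))) *ᵥ ψ) r =
      ∑ a, μ a * amp u (m + 2) ψ (Fin.cons (F a) (Fin.cons (G a) r)) := by
  rw [Matrix.sum_mulVec, amp_sum]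
  refine Finset.sum_congr rfl fun a _ => ?_
  rw [Matrix.smul_mulVec, amp_smul, amp_cons, amp_cons, mulVec_mulVec]

omit [DecidableEq κ] [Fintype κ] [Fintype L] in
/-- Pauli vanishing for the pair amplitudes: zero when `r` meets the pair `{F a, G a}`.
[folklore] -/
theorem amp_cons_cons_eq_zero (m : ℕ) (ψ : Fock ι) (r : Fin m → κ) (a : L)
    (h : (∃ t, r t = F a) ∨ (∃ t, r t = G a)) :
    amp u (m + 2) ψ (Fin.cons (F a) (Fin.cons (G a) r)) = 0 := by
  apply amp_eq_zero_of_not_injective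
  intro hinj
  rcases h with ⟨t, ht⟩ | ⟨t, ht⟩
  · have := @hinj 0 t.succ.succ (by simp [ht])
    exact Fin.succ_ne_zero _ this.symm
  · have key : (Fin.cons (F a) (Fin.cons (G a) r) : Fin (m + 2) → κ) (Fin.succ 0) =
        (Fin.cons (F a) (Fin.cons (G a) r) : Fin (m + 2) → κ) t.succ.succ := by
      simp only [Fin.cons_succ, Fin.cons_zero, ht]
    exact Fin.succ_ne_zero _ (Fin.succ_injective _ (hinj key)).symm

omit [DecidableEq κ] [Fintype κ] [Fintype L] in
/-- The pair amplitudes at level `m + 2` are level-`m` amplitudes of the pair-annihilated vector.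
[folklore] -/
theorem amp_cons_cons (m : ℕ) (ψ : Fock ι) (r : Fin m → κ) (a : L) :
    amp u (m + 2) ψ (Fin.cons (F a) (Fin.cons (G a) r)) =
      amp u m ((annihilate (u (G a)) * annihilate (u (F a))) *ᵥ ψ) r := by
  rw [amp_cons, amp_cons, mulVec_mulVec]

end Literature.MathematicalPhysics.QuantumLattice.RayleighBound

namespace Literature.MathematicalPhysics.QuantumLattice.RayleighBound

open Matrix Finset

/-- Resummation identity used in the core estimate. [folklore] -/
theorem yang_aux_sum_identity {L : Type*} [Fintype L] [DecidableEq L] (E : Finset L)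
    (w X : L → ℝ) (θ : ℝ) :
    ∑ a, ∑ b, (θ * w b + (1 - θ) * w a) * (if b ∈ E then X a else 0) =
      θ * ((∑ b ∈ E, w b) * ∑ a, X a) + (1 - θ) * (E.card * ∑ a, w a * X a) := by
  have h : ∀ a, ∑ b, (θ * w b + (1 - θ) * w a) * (if b ∈ E then X a else 0) =
      (θ * (∑ b ∈ E, w b) + (1 - θ) * (E.card * w a)) * X a := by
    intro a
    simp_rw [mul_ite, mul_zero]
    rw [Finset.sum_ite_mem, Finset.univ_inter, ← Finset.sum_mul, Finset.sum_add_distrib,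
      Finset.sum_const, nsmul_eq_mul, ← Finset.mul_sum]
    ring
  calc ∑ a, ∑ b, (θ * w b + (1 - θ) * w a) * (if b ∈ E then X a else 0)
      = ∑ a, (θ * (∑ b ∈ E, w b) + (1 - θ) * (E.card * w a)) * X a :=
        Finset.sum_congr rfl fun a _ => h a
    _ = ∑ a, (θ * ((∑ b ∈ E, w b) * X a) + (1 - θ) * (E.card * (w a * X a))) :=
        Finset.sum_congr rfl fun a _ => by ring
    _ = _ := by
        rw [Finset.sum_add_distrib, ← Finset.mul_sum, ← Finset.mul_sum, ← Finset.mul_sum,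
          ← Finset.mul_sum]

/-- Pointwise counting estimate in Yang's bound: for an injective `N`-tuple `j` of modes, with
`k` complete pairs inside (`2k ≤ N`) and `e` pairs outside (`2e + N ≤ M`), the weight attached to
`j` by the two Cauchy–Schwarz estimates is at most `T Σ_a w_a` as soon as `θ N/2 ≤ T` and
`1 + (1 - θ)(M - N)/2 ≤ T`. [folklore] -/
theorem yang_pointwise {L κ : Type*} [Fintype L] [DecidableEq L] [Fintype κ] [DecidableEq κ]
    (F G : L → κ) (hF : Function.Injective F) (hG : Function.Injective G)
    (hFG : ∀ a b, F a ≠ G b) {n : ℕ} (j : Fin n → κ) (hj : Function.Injective j)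
    (w : L → ℝ) (hw : ∀ a, 0 ≤ w a) {θ T : ℝ} (hθ0 : 0 ≤ θ) (hθ1 : θ ≤ 1)
    (hT1 : θ * (n / 2) ≤ T) (hT2 : 1 + (1 - θ) * ((Fintype.card κ - n) / 2) ≤ T) :
    ∑ a ∈ univ.filter (fun a => (∃ t, j t = F a) ∧ (∃ t, j t = G a)),
        ((θ * w a + (1 - θ) * w a) +
          ∑ b ∈ (univ.erase a).filter (fun b => (∀ t, j t ≠ F b) ∧ (∀ t, j t ≠ G b)),
            (θ * w b + (1 - θ) * w a)) ≤ T * ∑ a, w a := by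
  set full := univ.filter (fun a => (∃ t, j t = F a) ∧ (∃ t, j t = G a)) with hfull
  set emp := univ.filter (fun b => (∀ t, j t ≠ F b) ∧ (∀ t, j t ≠ G b)) with hemp
  have hk : 2 * full.card ≤ n :=
    two_mul_card_fullPairs_le F G hF hG hFG j full (fun a ha => by simpa [hfull] using ha)
  have he : 2 * emp.card + n ≤ Fintype.card κ :=
    two_mul_card_emptyPairs_add_le F G hF hG hFG j hj emp (fun b hb => by simpa [hemp] using hb)
  have hk' : (full.card : ℝ) ≤ n / 2 := by
    have := (Nat.cast_le (α := ℝ)).mpr hk; push_cast at this; linarith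
  have he' : (emp.card : ℝ) ≤ (Fintype.card κ - n) / 2 := by
    have := (Nat.cast_le (α := ℝ)).mpr he; push_cast at this; linarith
  have hdisj : Disjoint full emp := by
    rw [hfull, hemp, Finset.disjoint_filter]
    intro a _ h1 h2
    obtain ⟨t, ht⟩ := h1.1
    exact h2.1 t ht
  set Sf := ∑ a ∈ full, w a with hSf
  set Se := ∑ b ∈ emp, w b with hSe
  have hS : Sf + Se ≤ ∑ a, w a := by
    rw [hSf, hSe, ← Finset.sum_union hdisj]
    exact Finset.sum_le_sum_of_subset_of_nonneg (Finset.subset_univ _) (fun a _ _ => hw a)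
  have hSf0 : 0 ≤ Sf := Finset.sum_nonneg fun a _ => hw a
  have hSe0 : 0 ≤ Se := Finset.sum_nonneg fun a _ => hw a
  have h1θ : 0 ≤ 1 - θ := sub_nonneg.mpr hθ1
  have hT0 : 0 ≤ T := le_trans (mul_nonneg hθ0 (by positivity)) hT1
  have hinner : ∀ a ∈ full, (θ * w a + (1 - θ) * w a) +
      ∑ b ∈ (univ.erase a).filter (fun b => (∀ t, j t ≠ F b) ∧ (∀ t, j t ≠ G b)),
        (θ * w b + (1 - θ) * w a) ≤
      w a * (1 + (1 - θ) * ((Fintype.card κ - n) / 2)) + θ * Se := by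
    intro a _
    have hsub : (univ.erase a).filter (fun b => (∀ t, j t ≠ F b) ∧ (∀ t, j t ≠ G b)) ⊆ emp := by
      intro b hb
      rw [Finset.mem_filter] at hb
      rw [hemp, Finset.mem_filter]
      exact ⟨Finset.mem_univ _, hb.2⟩
    rw [Finset.sum_add_distrib, Finset.sum_const, nsmul_eq_mul, ← Finset.mul_sum]
    have h1 : ∑ b ∈ (univ.erase a).filter (fun b => (∀ t, j t ≠ F b) ∧ (∀ t, j t ≠ G b)), w b
        ≤ Se := Finset.sum_le_sum_of_subset_of_nonneg hsub (fun b _ _ => hw b)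
    have h2 : (((univ.erase a).filter (fun b => (∀ t, j t ≠ F b) ∧ (∀ t, j t ≠ G b))).card : ℝ)
        ≤ (Fintype.card κ - n) / 2 :=
      le_trans (by exact_mod_cast Finset.card_le_card hsub) he'
    nlinarith [hw a, mul_le_mul_of_nonneg_left h1 hθ0,
      mul_le_mul_of_nonneg_left h2 (mul_nonneg h1θ (hw a))]
  calc _ ≤ ∑ a ∈ full, (w a * (1 + (1 - θ) * ((Fintype.card κ - n) / 2)) + θ * Se) :=
        Finset.sum_le_sum hinner
    _ = Sf * (1 + (1 - θ) * ((Fintype.card κ - n) / 2)) + full.card * (θ * Se) := by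
        rw [Finset.sum_add_distrib, Finset.sum_const, nsmul_eq_mul, Finset.sum_mul]
    _ ≤ Sf * T + (n / 2) * (θ * Se) :=
        add_le_add (mul_le_mul_of_nonneg_left hT2 hSf0)
          (mul_le_mul_of_nonneg_right hk' (mul_nonneg hθ0 hSe0))
    _ = Sf * T + (θ * (n / 2)) * Se := by ring
    _ ≤ Sf * T + T * Se := add_le_add le_rfl (mul_le_mul_of_nonneg_right hT1 hSe0)
    _ = T * (Sf + Se) := by ring
    _ ≤ T * ∑ a, w a := mul_le_mul_of_nonneg_left hS hT0


variable {ι : Type*} [LinearOrder ι] [Fintype ι] {κ : Type*} [DecidableEq κ] [Fintype κ]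
  (u : κ → ι → ℂ) {L : Type*} [Fintype L] [DecidableEq L] (F G : L → κ)

/-- **Core estimate** (Yang's bound for a pair operator supported on a matching, in an arbitrary
orthonormal one-particle basis `u`): for a complete orthonormal family `u : κ → ℂ^ι`, injective
`F, G : L → κ` with disjoint ranges, weights `μ : L → ℂ` and an `(m + 2)`-particle `ψ`,
`‖(Σ_a μ_a c(u_{G a}) c(u_{F a})) ψ‖² ≤ N(M - N + 2)/(2M) · Σ_a |μ_a|² · ‖ψ‖²` with `N = m + 2`,
`M = |κ|`. This is the computational heart of Yang's bound `λ_max(ρ₂) ≤ N(M - N + 2)/M`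
(Yang, Rev. Mod. Phys. 34 (1962) 694, §3 and Appendix A, after reduction to the canonical form
of the pair function); the counting argument formalised here is the two-Cauchy–Schwarz device of
Tennie–Vedral–Schilling, Phys. Rev. B 96 (2017) 064502, Appendix A (see the module docstring).
[cite: YangODLRO1962, Appendix A] -/
theorem normSq_pairSum_mulVec_le
    (hu : ∀ k l, star (u k) ⬝ᵥ u l = if k = l then 1 else 0)
    (hu' : ∀ i j : ι, ∑ k, u k i * star (u k j) = if i = j then 1 else 0)
    (hF : Function.Injective F) (hG : Function.Injective G) (hFG : ∀ a b, F a ≠ G b)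
    (μ : L → ℂ) {m : ℕ} {ψ : Fock ι} (hψ : IsNParticle (m + 2) ψ) :
    normSq ((∑ a, μ a • (annihilate (u (G a)) * annihilate (u (F a)))) *ᵥ ψ) ≤
      (m + 2 : ℝ) * (Fintype.card κ - (m + 2) + 2) / (2 * Fintype.card κ) *
        (∑ a, ‖μ a‖ ^ 2) * normSq ψ := by
  -- Notation
  set B := ∑ a, μ a • (annihilate (u (G a)) * annihilate (u (F a))) with hB
  set Φ : (Fin (m + 2) → κ) → ℝ := fun j => ‖amp u (m + 2) ψ j‖ ^ 2 with hΦ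
  set A : L → (Fin m → κ) → ℂ := fun a r => amp u (m + 2) ψ (Fin.cons (F a) (Fin.cons (G a) r))
    with hA
  set E : (Fin m → κ) → Finset L := fun r =>
    univ.filter (fun b => (∀ t, r t ≠ F b) ∧ (∀ t, r t ≠ G b)) with hE
  have hΦ0 : ∀ j, 0 ≤ Φ j := fun j => by positivity
  have hsumΦ : ∑ j, Φ j = (m + 2).factorial * normSq ψ := sum_norm_amp_sq u hu' _ ψ hψ
  -- Step 0: the degenerate case `ψ = 0`
  by_cases hψ0 : normSq ψ = 0
  · have hz : ψ = 0 := by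
      funext s
      have := (Finset.sum_eq_zero_iff_of_nonneg (fun s _ => by positivity)).mp hψ0 s (mem_univ _)
      exact norm_eq_zero.mp (pow_eq_zero_iff two_ne_zero |>.mp this)
    rw [hz, mulVec_zero]
    simp [normSq]
  have hψpos : 0 < normSq ψ := lt_of_le_of_ne (normSq_nonneg ψ) (Ne.symm hψ0)
  -- `N ≤ M`, from the existence of an injective tuple with nonzero amplitude
  have hNM : m + 2 ≤ Fintype.card κ := by
    by_contra hlt
    have h0 : ∑ j, Φ j = 0 := Finset.sum_eq_zero fun j _ => by
      rw [hΦ]; dsimp only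
      rw [amp_eq_zero_of_not_injective u _ ψ j (fun hj => hlt ?_), norm_zero,
        zero_pow two_ne_zero]
      simpa using Fintype.card_le_of_injective j hj
    rw [hsumΦ] at h0
    exact absurd h0 (mul_ne_zero (by positivity) hψ0)
  set M : ℝ := (Fintype.card κ : ℝ) with hM
  set N : ℝ := (m : ℝ) + 2 with hN
  have hNM' : N ≤ M := by rw [hM, hN]; exact_mod_cast hNM
  have hN2 : (2 : ℝ) ≤ N := by rw [hN]; linarith [(Nat.cast_nonneg m : (0:ℝ) ≤ m)]
  have hM0 : 0 < M := by linarith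
  set θ : ℝ := (M - N + 2) / M with hθ
  have hθ0 : 0 ≤ θ := div_nonneg (by linarith) hM0.le
  have hθ1 : θ ≤ 1 := by rw [hθ, div_le_one hM0]; linarith
  set T : ℝ := N * (M - N + 2) / (2 * M) with hT
  have hTθ : θ + (1 - θ) * (1 + (M - N) / 2) = T := by
    rw [hθ, hT]; field_simp; ring
  have hTθ' : θ * (N / 2) = T := by rw [hθ, hT]; field_simp
  -- (K1) support of the pair amplitudes
  have K1 : ∀ r, ∀ a ∉ E r, A a r = 0 := fun r a ha => by
    rw [hA]; dsimp only
    apply amp_cons_cons_eq_zero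
    rw [hE] at ha
    simp only [Finset.mem_filter, Finset.mem_univ, true_and, not_and_or, not_forall, not_not] at ha
    exact ha
  -- (K2) the empty pairs besides `a` are few when `A a r ≠ 0`
  have K2 : ∀ r a, A a r ≠ 0 → 2 * ((E r).erase a).card + (m + 2) ≤ Fintype.card κ := by
    intro r a hne
    have hinj : Function.Injective (Fin.cons (F a) (Fin.cons (G a) r) : Fin (m + 2) → κ) := by
      by_contra h
      exact hne (amp_eq_zero_of_not_injective u _ ψ _ h)
    refine two_mul_card_emptyPairs_add_le F G hF hG hFG _ hinj _ fun b hb => ?_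
    rw [Finset.mem_erase, hE, Finset.mem_filter] at hb
    obtain ⟨hba, -, hbF, hbG⟩ := hb
    constructor
    · intro t
      refine Fin.cases ?_ (fun t' => Fin.cases ?_ (fun t'' => ?_) t') t
      · simpa using fun h => hba (hF h).symm
      · simpa using (hFG b a).symm
      · simpa using hbF t''
    · intro t
      refine Fin.cases ?_ (fun t' => Fin.cases ?_ (fun t'' => ?_) t') t
      · simpa using hFG a b
      · simpa using fun h => hba (hG h).symm
      · simpa using hbG t''
  -- particle-number bookkeeping
  have hpair : ∀ a (φ : Fock ι), IsNParticle (m + 2) φ →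
      IsNParticle m ((annihilate (u (G a)) * annihilate (u (F a))) *ᵥ φ) := fun a φ hφ => by
    rw [← mulVec_mulVec]; exact (hφ.annihilate_mulVec _).annihilate_mulVec _
  have hfact : ((m + 2).factorial : ℝ) = (m + 2 : ℝ) * (m + 1) * m.factorial := by
    rw [Nat.factorial_succ, Nat.factorial_succ]; push_cast; ring
  -- (K3) conversion of `Σ_r |A a r|²` to a sum over full tuples
  have K3 : ∀ a, (m + 2 : ℝ) * (m + 1) * ∑ r, ‖A a r‖ ^ 2 =
      ∑ j ∈ univ.filter (fun j : Fin (m + 2) → κ => (∃ t, j t = F a) ∧ (∃ t, j t = G a)), Φ j := by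
    intro a
    have h1 : ∑ r, ‖A a r‖ ^ 2 =
        m.factorial * normSq ((annihilate (u (G a)) * annihilate (u (F a))) *ᵥ ψ) := by
      rw [← sum_norm_amp_sq u hu' m _ (hpair a ψ hψ)]
      refine Finset.sum_congr rfl fun r _ => ?_
      rw [hA]; dsimp only; rw [amp_cons_cons]
    have h2 := sum_norm_amp_numberMode_numberMode_sq u hu (m + 2) ψ (F a) (G a)
    rw [sum_norm_amp_sq u hu' _ _ ((hψ.numberMode_mulVec _).numberMode_mulVec _),
      ← normSq_pair_mulVec u hu (hFG a a), hfact] at h2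
    rw [hΦ, ← h2, h1]; ring
  -- (K4) conversion of `Σ_r [b ∈ E r] |A a r|²`
  have K4 : ∀ a b, a ≠ b → (m + 2 : ℝ) * (m + 1) * ∑ r, (if b ∈ E r then ‖A a r‖ ^ 2 else 0) =
      ∑ j ∈ univ.filter (fun j : Fin (m + 2) → κ => ((∃ t, j t = F a) ∧ (∃ t, j t = G a)) ∧
        ((∀ t, j t ≠ F b) ∧ (∀ t, j t ≠ G b))), Φ j := by
    intro a b hab
    set P := (1 - numberMode (u (F b))) * (1 - numberMode (u (G b))) with hP
    have hPψ : IsNParticle (m + 2) (P *ᵥ ψ) := by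
      rw [hP, ← mulVec_mulVec]
      exact (hψ.one_sub_numberMode_mulVec _).one_sub_numberMode_mulVec _
    have hcomm : P * (annihilate (u (G a)) * annihilate (u (F a))) =
        (annihilate (u (G a)) * annihilate (u (F a))) * P := by
      have c11 : Commute (annihilate (u (G a))) (1 - numberMode (u (F b))) :=
        annihilate_mul_one_sub_numberMode_comm u hu (hFG b a).symm
      have c12 : Commute (annihilate (u (G a))) (1 - numberMode (u (G b))) :=
        annihilate_mul_one_sub_numberMode_comm u hu (hG.ne hab)
      have c21 : Commute (annihilate (u (F a))) (1 - numberMode (u (F b))) :=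
        annihilate_mul_one_sub_numberMode_comm u hu (hF.ne hab)
      have c22 : Commute (annihilate (u (F a))) (1 - numberMode (u (G b))) :=
        annihilate_mul_one_sub_numberMode_comm u hu (hFG a b)
      rw [hP]
      exact (((c11.mul_right c12).mul_left (c21.mul_right c22)).eq).symm
    have h1 : ∑ r, (if b ∈ E r then ‖A a r‖ ^ 2 else 0) =
        m.factorial * normSq ((annihilate (u (G a)) * annihilate (u (F a))) *ᵥ (P *ᵥ ψ)) := by
      have hv : (annihilate (u (G a)) * annihilate (u (F a))) *ᵥ (P *ᵥ ψ) =
          (1 - numberMode (u (F b))) *ᵥ ((1 - numberMode (u (G b))) *ᵥ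
            ((annihilate (u (G a)) * annihilate (u (F a))) *ᵥ ψ)) := by
        rw [mulVec_mulVec, ← hcomm, hP, ← mulVec_mulVec, ← mulVec_mulVec]
      rw [hv, ← sum_norm_amp_sq u hu' m _
        (((hpair a ψ hψ).one_sub_numberMode_mulVec _).one_sub_numberMode_mulVec _)]
      refine Finset.sum_congr rfl fun r _ => ?_
      rw [norm_amp_emptyProj_sq u hu, hA]
      dsimp only
      rw [amp_cons_cons, hE]
      simp only [Finset.mem_filter, Finset.mem_univ, true_and]
    have h2 := sum_norm_amp_numberMode_numberMode_sq u hu (m + 2) (P *ᵥ ψ) (F a) (G a)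
    rw [sum_norm_amp_sq u hu' _ _ ((hPψ.numberMode_mulVec _).numberMode_mulVec _),
      ← normSq_pair_mulVec u hu (hFG a a), hfact] at h2
    have h3 : ∑ j ∈ univ.filter (fun j : Fin (m + 2) → κ => (∃ t, j t = F a) ∧ (∃ t, j t = G a)),
        ‖amp u (m + 2) (P *ᵥ ψ) j‖ ^ 2 =
        ∑ j ∈ univ.filter (fun j : Fin (m + 2) → κ => ((∃ t, j t = F a) ∧ (∃ t, j t = G a)) ∧
          ((∀ t, j t ≠ F b) ∧ (∀ t, j t ≠ G b))), Φ j := by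
      rw [Finset.sum_filter, Finset.sum_filter]
      refine Finset.sum_congr rfl fun j _ => ?_
      rw [hP, ← mulVec_mulVec, norm_amp_emptyProj_sq u hu]
      by_cases hq : (∀ t, j t ≠ F b) ∧ ∀ t, j t ≠ G b
      · rw [if_pos hq]
        by_cases hp : (∃ t, j t = F a) ∧ ∃ t, j t = G a
        · rw [if_pos hp, if_pos ⟨hp, hq⟩]
        · rw [if_neg hp, if_neg (fun h => hp h.1)]
      · rw [if_neg hq, ite_self, if_neg (fun h => hq h.2)]
    rw [← h3, ← h2, h1]; ring
  -- (K5) particle number and amplitudes of `B ψ`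
  have hBψ : IsNParticle m (B *ᵥ ψ) := by
    intro s hs
    rw [hB, Matrix.sum_mulVec, Finset.sum_apply]
    refine Finset.sum_eq_zero fun a _ => ?_
    rw [Matrix.smul_mulVec, Pi.smul_apply, hpair a ψ hψ s hs, smul_zero]
  have K5 : (m.factorial : ℝ) * normSq (B *ᵥ ψ) = ∑ r, ‖∑ a, μ a * A a r‖ ^ 2 := by
    rw [← sum_norm_amp_sq u hu' m _ hBψ]
    refine Finset.sum_congr rfl fun r _ => ?_
    rw [hB, amp_pairSum_mulVec, hA]
  -- (K6) the two Cauchy–Schwarz estimates, pointwise in `r`, resummed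
  have K6 : ∑ r, ‖∑ a, μ a * A a r‖ ^ 2 ≤
      ∑ a, ∑ b, (θ * ‖μ b‖ ^ 2 + (1 - θ) * ‖μ a‖ ^ 2) *
        ∑ r, (if b ∈ E r then ‖A a r‖ ^ 2 else 0) := by
    calc ∑ r, ‖∑ a, μ a * A a r‖ ^ 2
        ≤ ∑ r, (θ * ((∑ b ∈ E r, ‖μ b‖ ^ 2) * ∑ a, ‖A a r‖ ^ 2) +
            (1 - θ) * ((E r).card * ∑ a, ‖μ a‖ ^ 2 * ‖A a r‖ ^ 2)) :=
          Finset.sum_le_sum fun r _ =>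
            norm_sum_mul_sq_le_convex (E r) μ (fun a => A a r) (K1 r) hθ0 hθ1
      _ = ∑ r, ∑ a, ∑ b, (θ * ‖μ b‖ ^ 2 + (1 - θ) * ‖μ a‖ ^ 2) *
            (if b ∈ E r then ‖A a r‖ ^ 2 else 0) :=
          Finset.sum_congr rfl fun r _ =>
            (yang_aux_sum_identity (E r) (fun a => ‖μ a‖ ^ 2) (fun a => ‖A a r‖ ^ 2) θ).symm
      _ = _ := by
          rw [Finset.sum_comm]
          refine Finset.sum_congr rfl fun a _ => ?_
          rw [Finset.sum_comm]
          refine Finset.sum_congr rfl fun b _ => ?_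
          rw [Finset.mul_sum]
  -- (K3') diagonal conversion, with the indicator made explicit
  have K3' : ∀ a, (m + 2 : ℝ) * (m + 1) * ∑ r, (if a ∈ E r then ‖A a r‖ ^ 2 else 0) =
      ∑ j ∈ univ.filter (fun j : Fin (m + 2) → κ => (∃ t, j t = F a) ∧ (∃ t, j t = G a)),
        Φ j := by
    intro a
    rw [← K3 a]
    congr 1
    refine Finset.sum_congr rfl fun r _ => ?_
    split_ifs with h
    · rfl
    · rw [K1 r a h, norm_zero, zero_pow two_ne_zero]
  -- (K7) resummation over complete tuples `j`
  have K7 : (m + 2 : ℝ) * (m + 1) *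
      ∑ a, ∑ b, (θ * ‖μ b‖ ^ 2 + (1 - θ) * ‖μ a‖ ^ 2) *
        ∑ r, (if b ∈ E r then ‖A a r‖ ^ 2 else 0) =
      ∑ j, Φ j * ∑ a ∈ univ.filter (fun a => (∃ t, j t = F a) ∧ (∃ t, j t = G a)),
        ((θ * ‖μ a‖ ^ 2 + (1 - θ) * ‖μ a‖ ^ 2) +
          ∑ b ∈ (univ.erase a).filter (fun b => (∀ t, j t ≠ F b) ∧ (∀ t, j t ≠ G b)),
            (θ * ‖μ b‖ ^ 2 + (1 - θ) * ‖μ a‖ ^ 2)) := by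
    have hR : ∀ j : Fin (m + 2) → κ,
        Φ j * ∑ a ∈ univ.filter (fun a => (∃ t, j t = F a) ∧ (∃ t, j t = G a)),
          ((θ * ‖μ a‖ ^ 2 + (1 - θ) * ‖μ a‖ ^ 2) +
            ∑ b ∈ (univ.erase a).filter (fun b => (∀ t, j t ≠ F b) ∧ (∀ t, j t ≠ G b)),
              (θ * ‖μ b‖ ^ 2 + (1 - θ) * ‖μ a‖ ^ 2)) =
        ∑ a, if (∃ t, j t = F a) ∧ (∃ t, j t = G a) then
          Φ j * ((θ * ‖μ a‖ ^ 2 + (1 - θ) * ‖μ a‖ ^ 2) +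
            ∑ b ∈ (univ.erase a).filter (fun b => (∀ t, j t ≠ F b) ∧ (∀ t, j t ≠ G b)),
              (θ * ‖μ b‖ ^ 2 + (1 - θ) * ‖μ a‖ ^ 2)) else 0 := by
      intro j
      rw [Finset.mul_sum, Finset.sum_filter]
    have hL : ∀ a, (m + 2 : ℝ) * (m + 1) * ∑ b, (θ * ‖μ b‖ ^ 2 + (1 - θ) * ‖μ a‖ ^ 2) *
        ∑ r, (if b ∈ E r then ‖A a r‖ ^ 2 else 0) =
        ∑ j : Fin (m + 2) → κ, if (∃ t, j t = F a) ∧ (∃ t, j t = G a) then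
          Φ j * ((θ * ‖μ a‖ ^ 2 + (1 - θ) * ‖μ a‖ ^ 2) +
            ∑ b ∈ (univ.erase a).filter (fun b => (∀ t, j t ≠ F b) ∧ (∀ t, j t ≠ G b)),
              (θ * ‖μ b‖ ^ 2 + (1 - θ) * ‖μ a‖ ^ 2)) else 0 := by
      intro a
      have e1 : ∀ b, (m + 2 : ℝ) * (m + 1) * ((θ * ‖μ b‖ ^ 2 + (1 - θ) * ‖μ a‖ ^ 2) *
          ∑ r, (if b ∈ E r then ‖A a r‖ ^ 2 else 0)) =
          (θ * ‖μ b‖ ^ 2 + (1 - θ) * ‖μ a‖ ^ 2) *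
            ((m + 2 : ℝ) * (m + 1) * ∑ r, (if b ∈ E r then ‖A a r‖ ^ 2 else 0)) :=
        fun b => by ring
      rw [Finset.mul_sum]
      simp_rw [e1]
      rw [← Finset.add_sum_erase _ _ (Finset.mem_univ a), K3' a]
      have e2 : ∑ b ∈ univ.erase a, (θ * ‖μ b‖ ^ 2 + (1 - θ) * ‖μ a‖ ^ 2) *
          ((m + 2 : ℝ) * (m + 1) * ∑ r, (if b ∈ E r then ‖A a r‖ ^ 2 else 0)) =
          ∑ b ∈ univ.erase a, ∑ j : Fin (m + 2) → κ,
            (if ((∃ t, j t = F a) ∧ (∃ t, j t = G a)) ∧ ((∀ t, j t ≠ F b) ∧ (∀ t, j t ≠ G b))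
              then (θ * ‖μ b‖ ^ 2 + (1 - θ) * ‖μ a‖ ^ 2) * Φ j else 0) := by
        refine Finset.sum_congr rfl fun b hb => ?_
        rw [K4 a b (Finset.ne_of_mem_erase hb).symm, Finset.mul_sum, Finset.sum_filter]
      have e3 : (θ * ‖μ a‖ ^ 2 + (1 - θ) * ‖μ a‖ ^ 2) *
          ∑ j ∈ univ.filter (fun j : Fin (m + 2) → κ => (∃ t, j t = F a) ∧ (∃ t, j t = G a)),
            Φ j =
          ∑ j : Fin (m + 2) → κ, (if (∃ t, j t = F a) ∧ (∃ t, j t = G a)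
              then (θ * ‖μ a‖ ^ 2 + (1 - θ) * ‖μ a‖ ^ 2) * Φ j else 0) := by
        rw [Finset.mul_sum, Finset.sum_filter]
      rw [e3, e2, Finset.sum_comm, ← Finset.sum_add_distrib]
      refine Finset.sum_congr rfl fun j _ => ?_
      by_cases h : (∃ t, j t = F a) ∧ (∃ t, j t = G a)
      · simp only [h, true_and, and_self, ite_true]
        rw [Finset.sum_filter, mul_add, Finset.mul_sum]
        congr 1
        · ring
        · refine Finset.sum_congr rfl fun b _ => ?_
          rw [mul_ite, mul_zero]
          split_ifs <;> ring
      · simp only [h, false_and, ite_false, Finset.sum_const_zero, add_zero]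
    rw [Finset.mul_sum]
    simp_rw [hL, hR]
    exact Finset.sum_comm
  -- (K8) the pointwise counting bound
  have hT1 : θ * (((m + 2 : ℕ) : ℝ) / 2) ≤ T := by
    push_cast
    rw [← hN]
    exact hTθ'.le
  have hT2 : 1 + (1 - θ) * ((Fintype.card κ - ((m + 2 : ℕ) : ℝ)) / 2) ≤ T := by
    push_cast
    rw [← hN, ← hM]
    linarith [hTθ]
  have K8 : ∑ j, Φ j * ∑ a ∈ univ.filter (fun a => (∃ t, j t = F a) ∧ (∃ t, j t = G a)),
        ((θ * ‖μ a‖ ^ 2 + (1 - θ) * ‖μ a‖ ^ 2) +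
          ∑ b ∈ (univ.erase a).filter (fun b => (∀ t, j t ≠ F b) ∧ (∀ t, j t ≠ G b)),
            (θ * ‖μ b‖ ^ 2 + (1 - θ) * ‖μ a‖ ^ 2)) ≤
      ∑ j, Φ j * (T * ∑ a, ‖μ a‖ ^ 2) := by
    refine Finset.sum_le_sum fun j _ => ?_
    by_cases hj : Function.Injective j
    · exact mul_le_mul_of_nonneg_left (yang_pointwise F G hF hG hFG j hj (fun a => ‖μ a‖ ^ 2)
        (fun a => by positivity) hθ0 hθ1 hT1 hT2) (hΦ0 j)
    · have h0 : Φ j = 0 := by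
        rw [hΦ]; dsimp only
        rw [amp_eq_zero_of_not_injective u _ ψ j hj, norm_zero, zero_pow two_ne_zero]
      rw [h0, zero_mul, zero_mul]
  -- (K9) conclusion
  have hpos : (0 : ℝ) < (m + 2 : ℝ) * (m + 1) * m.factorial := by positivity
  refine le_of_mul_le_mul_left ?_ hpos
  calc (m + 2 : ℝ) * (m + 1) * m.factorial * normSq (B *ᵥ ψ)
      = (m + 2 : ℝ) * (m + 1) * ((m.factorial : ℝ) * normSq (B *ᵥ ψ)) := by ring
    _ ≤ (m + 2 : ℝ) * (m + 1) * ∑ a, ∑ b, (θ * ‖μ b‖ ^ 2 + (1 - θ) * ‖μ a‖ ^ 2) *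
          ∑ r, (if b ∈ E r then ‖A a r‖ ^ 2 else 0) := by
        rw [K5]; exact mul_le_mul_of_nonneg_left K6 (by positivity)
    _ = _ := K7
    _ ≤ ∑ j, Φ j * (T * ∑ a, ‖μ a‖ ^ 2) := K8
    _ = (m + 2).factorial * normSq ψ * (T * ∑ a, ‖μ a‖ ^ 2) := by rw [← Finset.sum_mul, hsumΦ]
    _ = (m + 2 : ℝ) * (m + 1) * m.factorial * (T * (∑ a, ‖μ a‖ ^ 2) * normSq ψ) := by
        rw [hfact]; ring

end Literature.MathematicalPhysics.QuantumLattice.RayleighBound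

/-! ## Assembly of Yang's bound -/

namespace Literature.MathematicalPhysics.QuantumLattice.RayleighBound

open Matrix Finset
open scoped InnerProductSpace

section PairOp

variable {ι : Type*} [LinearOrder ι] [Fintype ι]

/-- The pair-annihilation operator `Δ(w) = Σ_{k,l} w k l • c_l c_k` of a pair wavefunction `w`.
Yang, Rev. Mod. Phys. 34 (1962) 694, §3. [folklore] -/
def pairOp (w : ι → ι → ℂ) : Matrix (Finset ι) (Finset ι) ℂ :=
  ∑ k, ∑ l, w k l • (annihilation l * annihilation k)

/-- `Δ` is additive. [folklore] -/
theorem pairOp_add (w w' : ι → ι → ℂ) : pairOp (w + w') = pairOp w + pairOp w' := by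
  simp only [pairOp, Pi.add_apply, add_smul, Finset.sum_add_distrib]

/-- `Δ` is homogeneous. [folklore] -/
theorem pairOp_smul (c : ℂ) (w : ι → ι → ℂ) : pairOp (c • w) = c • pairOp w := by
  simp only [pairOp, Pi.smul_apply, smul_eq_mul, mul_smul, Finset.smul_sum]

/-- `Δ` of a difference. [folklore] -/
theorem pairOp_sub (w w' : ι → ι → ℂ) : pairOp (w - w') = pairOp w - pairOp w' := by
  simp only [pairOp, Pi.sub_apply, sub_smul, Finset.sum_sub_distrib]

/-- `Δ` of a finite sum. [folklore] -/
theorem pairOp_sum {L : Type*} (s : Finset L) (w : L → ι → ι → ℂ) :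
    pairOp (∑ a ∈ s, w a) = ∑ a ∈ s, pairOp (w a) := by
  classical
  induction s using Finset.induction_on with
  | empty => simp [pairOp]
  | insert a s ha ih => rw [Finset.sum_insert ha, Finset.sum_insert ha, pairOp_add, ih]

/-- `Δ` of the product pair wavefunction `(k, l) ↦ conj (p k) conj (q l)` is `c(q) c(p)`.
[folklore] -/
theorem pairOp_mul_fun (p q : ι → ℂ) :
    pairOp (fun k l => star (p k) * star (q l)) = annihilate q * annihilate p := by
  simp only [pairOp, annihilate, Finset.sum_mul, Finset.mul_sum, smul_mul_smul_comm]
  exact Finset.sum_congr rfl fun k _ => Finset.sum_congr rfl fun l _ => by congr 1; ring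

/-- `Δ` only sees the antisymmetric part: `Δ(w) = Δ((w - wᵀ)/2)` (pure CAR). [folklore] -/
theorem pairOp_eq_pairOp_antisymm (w : ι → ι → ℂ) :
    pairOp w = pairOp (fun k l => (w k l - w l k) / 2) := by
  have hanti : ∀ k l : ι, annihilation l * annihilation k = -(annihilation k * annihilation l) :=
    fun k l => eq_neg_of_add_eq_zero_left (annihilation_anticommute_holds (ι := ι) l k)
  have hT : pairOp (fun k l => w l k) = -pairOp w := by
    simp only [pairOp]
    rw [Finset.sum_comm, ← Finset.sum_neg_distrib]
    refine Finset.sum_congr rfl fun k _ => ?_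
    rw [← Finset.sum_neg_distrib]
    refine Finset.sum_congr rfl fun l _ => ?_
    rw [hanti l k, smul_neg]
  have hfun : (fun k l => (w k l - w l k) / 2) = (1 / 2 : ℂ) • (w - fun k l => w l k) := by
    funext k l
    simp only [Pi.smul_apply, Pi.sub_apply, smul_eq_mul]
    ring
  rw [hfun, pairOp_smul, pairOp_sub, hT, sub_neg_eq_add, ← two_smul ℂ (pairOp w), smul_smul]
  norm_num

/-- **`⟨v, ρ₂ v⟩ = ‖Δ(v) ψ‖²`**: the Rayleigh quotient of Yang's `ρ₂` at the pair wavefunction `v`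
is the squared norm of the pair-annihilated state. Yang, Rev. Mod. Phys. 34 (1962) 694, §3.
[folklore] -/
theorem star_dotProduct_twoParticleRDM_mulVec (ψ : Fock ι) (v : ι × ι → ℂ) :
    star v ⬝ᵥ (twoParticleRDM ψ *ᵥ v) =
      star (pairOp (fun k l => v (k, l)) *ᵥ ψ) ⬝ᵥ (pairOp (fun k l => v (k, l)) *ᵥ ψ) := by
  have hP : pairOp (fun k l => v (k, l)) *ᵥ ψ =
      ∑ q : ι × ι, v q • ((annihilation q.2 * annihilation q.1) *ᵥ ψ) := by
    rw [pairOp, Fintype.sum_prod_type, Matrix.sum_mulVec]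
    refine Finset.sum_congr rfl fun k _ => ?_
    rw [Matrix.sum_mulVec]
    refine Finset.sum_congr rfl fun l _ => ?_
    rw [Matrix.smul_mulVec]
  rw [hP, star_sum, sum_dotProduct]
  simp only [dotProduct_sum, star_smul, smul_dotProduct, dotProduct_smul, smul_eq_mul]
  rw [dotProduct, Finset.sum_congr rfl]
  intro p _
  rw [Pi.star_apply, mulVec, dotProduct, Finset.mul_sum]
  refine Finset.sum_congr rfl fun q _ => ?_
  rw [twoParticleRDM, expect, star_mulVec_dotProduct, mulVec_mulVec, conjTranspose_mul, creation,
    creation]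
  simp only [← mul_assoc]
  ring

omit [LinearOrder ι] in
/-- `‖c • φ‖² = |c|² ‖φ‖²`. [folklore] -/
theorem normSq_smul (c : ℂ) (φ : Fock ι) : normSq (c • φ) = ‖c‖ ^ 2 * normSq φ := by
  simp only [normSq, Pi.smul_apply, smul_eq_mul, norm_mul, mul_pow, Finset.mul_sum]

end PairOp

section Frobenius

variable {ι : Type*} [Fintype ι]

/-- A four-fold resummation: `Σ_{k,l} (Σ_a s_a P_a(k,l)) (Σ_b s_b Q_b(k,l)) = c Σ_a s_a²` when
`Σ_{k,l} P_a Q_b = c δ_{ab}`. [folklore] -/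
theorem sum_sum_mul_sum_eq {α : Type*} [Fintype α] [DecidableEq α] (s : α → ℂ)
    (P Q : α → ι → ι → ℂ) (c : ℂ)
    (hPQ : ∀ a b, ∑ k, ∑ l, P a k l * Q b k l = if a = b then c else 0) :
    ∑ k, ∑ l, (∑ a, s a * P a k l) * (∑ b, s b * Q b k l) = c * ∑ a, s a * s a := by
  calc ∑ k, ∑ l, (∑ a, s a * P a k l) * (∑ b, s b * Q b k l)
      = ∑ k, ∑ l, ∑ a, ∑ b, (s a * s b) * (P a k l * Q b k l) := by
        refine Finset.sum_congr rfl fun k _ => Finset.sum_congr rfl fun l _ => ?_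
        rw [Finset.sum_mul_sum]
        exact Finset.sum_congr rfl fun a _ => Finset.sum_congr rfl fun b _ => by ring
    _ = ∑ kl : ι × ι, ∑ ab : α × α, (s ab.1 * s ab.2) * (P ab.1 kl.1 kl.2 * Q ab.2 kl.1 kl.2) := by
        simp only [Fintype.sum_prod_type]
    _ = ∑ ab : α × α, ∑ kl : ι × ι, (s ab.1 * s ab.2) * (P ab.1 kl.1 kl.2 * Q ab.2 kl.1 kl.2) :=
        Finset.sum_comm
    _ = ∑ a, ∑ b, (s a * s b) * ∑ k, ∑ l, P a k l * Q b k l := by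
        simp only [Fintype.sum_prod_type, Finset.mul_sum]
    _ = ∑ a, ∑ b, (s a * s b) * (if a = b then c else 0) := by simp_rw [hPQ]
    _ = ∑ a, (s a * s a) * c := by
        refine Finset.sum_congr rfl fun a _ => ?_
        simp_rw [mul_ite, mul_zero]
        rw [Finset.sum_ite_eq, if_pos (Finset.mem_univ a)]
    _ = c * ∑ a, s a * s a := by
        rw [Finset.mul_sum]
        exact Finset.sum_congr rfl fun a _ => by ring

/-- Squared Frobenius norm of a matrix in Youla normal form: if `(x_a, y_a)_a` is an orthonormal
family then `Σ_{k,l} |Σ_a σ_a (ȳ_a(k) x̄_a(l) - x̄_a(k) ȳ_a(l))|² = 2 Σ_a σ_a²`. [folklore] -/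
theorem sum_norm_sq_skewNormalForm {n : ℕ} (x y : Fin n → ι → ℂ) (σ : Fin n → ℝ)
    (hxx : ∀ a b, star (x a) ⬝ᵥ x b = if a = b then 1 else 0)
    (hyy : ∀ a b, star (y a) ⬝ᵥ y b = if a = b then 1 else 0)
    (hxy : ∀ a b, star (x a) ⬝ᵥ y b = 0) :
    ∑ k, ∑ l, ‖∑ a, (σ a : ℂ) * (star (y a k) * star (x a l) - star (x a k) * star (y a l))‖ ^ 2 =
      2 * ∑ a, σ a ^ 2 := by
  have dp : ∀ p q : ι → ℂ, star p ⬝ᵥ q = ∑ k, star (p k) * q k := fun p q => rfl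
  have hyx : ∀ a b, star (y a) ⬝ᵥ x b = 0 := fun a b => by
    rw [star_dotProduct, hxy, star_zero]
  have hsr : ∀ r : ℝ, star (r : ℂ) = r := fun r => by rw [Complex.star_def, Complex.conj_ofReal]
  -- the key orthogonality computation
  have inner : ∀ a b, ∑ k, ∑ l, (y a k * x a l - x a k * y a l) *
      (star (y b k) * star (x b l) - star (x b k) * star (y b l)) = if a = b then 2 else 0 := by
    intro a b
    have e : ∀ k l, (y a k * x a l - x a k * y a l) *
        (star (y b k) * star (x b l) - star (x b k) * star (y b l)) =
        (star (y b k) * y a k) * (star (x b l) * x a l) -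
          (star (x b k) * y a k) * (star (y b l) * x a l) -
          (star (y b k) * x a k) * (star (x b l) * y a l) +
          (star (x b k) * x a k) * (star (y b l) * y a l) := fun k l => by ring
    simp_rw [e]
    simp only [Finset.sum_add_distrib, Finset.sum_sub_distrib]
    simp only [← Finset.sum_mul_sum, ← dp, hxx, hyy, hxy, hyx]
    by_cases hab : a = b
    · subst hab; norm_num
    · simp [hab, Ne.symm hab]
  have hstar : ∀ k l, star (∑ a, (σ a : ℂ) * (star (y a k) * star (x a l) - star (x a k) * star (y a l))) =
      ∑ a, (σ a : ℂ) * (y a k * x a l - x a k * y a l) := by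
    intro k l
    rw [star_sum]
    refine Finset.sum_congr rfl fun a _ => ?_
    simp only [star_mul', star_sub, star_star, hsr]
  have hC : ∀ z : ℂ, ((‖z‖ : ℂ)) ^ 2 = star z * z := fun z => by
    rw [Complex.star_def, Complex.conj_mul']
  apply Complex.ofReal_injective
  push_cast
  simp_rw [hC, hstar]
  rw [show (2 : ℂ) * ∑ a, (σ a : ℂ) ^ 2 = 2 * ∑ a, (σ a : ℂ) * (σ a : ℂ) by simp_rw [sq]]
  exact sum_sum_mul_sum_eq (fun a => (σ a : ℂ)) (fun a k l => y a k * x a l - x a k * y a l)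
    (fun b k l => star (y b k) * star (x b l) - star (x b k) * star (y b l)) 2 inner

/-- Antisymmetrisation does not increase the Frobenius norm:
`Σ_{k,l} |(w k l - w l k)/2|² ≤ Σ_{k,l} |w k l|²`. [folklore] -/
theorem sum_norm_sq_antisymm_le (w : ι → ι → ℂ) :
    ∑ k, ∑ l, ‖(w k l - w l k) / 2‖ ^ 2 ≤ ∑ k, ∑ l, ‖w k l‖ ^ 2 := by
  have h : ∀ k l, ‖(w k l - w l k) / 2‖ ^ 2 ≤ (‖w k l‖ ^ 2 + ‖w l k‖ ^ 2) / 2 := by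
    intro k l
    have h1 : ‖(w k l - w l k) / 2‖ ≤ (‖w k l‖ + ‖w l k‖) / 2 := by
      rw [norm_div, Complex.norm_two]
      exact div_le_div_of_nonneg_right (norm_sub_le _ _) zero_le_two
    calc ‖(w k l - w l k) / 2‖ ^ 2 ≤ ((‖w k l‖ + ‖w l k‖) / 2) ^ 2 :=
          pow_le_pow_left₀ (norm_nonneg _) h1 2
      _ ≤ _ := by nlinarith [sq_nonneg (‖w k l‖ - ‖w l k‖)]
  calc ∑ k, ∑ l, ‖(w k l - w l k) / 2‖ ^ 2 ≤ ∑ k, ∑ l, (‖w k l‖ ^ 2 + ‖w l k‖ ^ 2) / 2 :=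
        Finset.sum_le_sum fun k _ => Finset.sum_le_sum fun l _ => h k l
    _ = (∑ k, ∑ l, ‖w k l‖ ^ 2 + ∑ k, ∑ l, ‖w l k‖ ^ 2) / 2 := by
        rw [← Finset.sum_add_distrib, Finset.sum_div]
        refine Finset.sum_congr rfl fun k _ => ?_
        rw [← Finset.sum_add_distrib, Finset.sum_div]
    _ = _ := by
        rw [Finset.sum_comm (f := fun k l => ‖w l k‖ ^ 2)]
        ring

/-- An orthonormal family whose size is the dimension is complete:
`Σ_k u_k(i) conj (u_k(j)) = δ_{ij}` (the matrix of the family is unitary). [folklore] -/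
theorem complete_of_orthonormal [DecidableEq ι] {κ : Type*} [Fintype κ] [DecidableEq κ]
    (u : κ → ι → ℂ) (hu : ∀ k l, star (u k) ⬝ᵥ u l = if k = l then 1 else 0)
    (hcard : Fintype.card κ = Fintype.card ι) :
    ∀ i j, ∑ k, u k i * star (u k j) = if i = j then 1 else 0 := by
  set U : Matrix ι κ ℂ := Matrix.of fun i k => u k i with hU
  have h1 : Uᴴ * U = 1 := by
    ext k l
    rw [Matrix.mul_apply, Matrix.one_apply, ← hu k l]
    rfl
  have h2 : U * Uᴴ = 1 := (Matrix.mul_eq_one_comm_of_equiv (Fintype.equivOfCardEq hcard)).mp h1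
  intro i j
  have h3 := congr_fun (congr_fun h2 i) j
  rw [Matrix.mul_apply, Matrix.one_apply] at h3
  exact h3

end Frobenius

section Extension

universe u

variable {ι : Type u} [Fintype ι]

/-- Extension of the orthonormal family `(x_a, y_a)_a` to an orthonormal basis `u` of `ℂ^ι`
(Gram–Schmidt, via Mathlib's `Orthonormal.exists_orthonormalBasis_extension`), packaged for the
core estimate: `u ∘ F = y`, `u ∘ G = x`. [folklore] -/
theorem exists_orthonormal_extension {n : ℕ} (x y : Fin n → ι → ℂ)
    (hxx : ∀ a b, star (x a) ⬝ᵥ x b = if a = b then 1 else 0)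
    (hyy : ∀ a b, star (y a) ⬝ᵥ y b = if a = b then 1 else 0)
    (hxy : ∀ a b, star (x a) ⬝ᵥ y b = 0) :
    ∃ (κ : Type u) (_ : Fintype κ) (_ : DecidableEq κ) (u : κ → ι → ℂ) (F G : Fin n → κ),
      (∀ k l, star (u k) ⬝ᵥ u l = if k = l then 1 else 0) ∧
      Fintype.card κ = Fintype.card ι ∧
      Function.Injective F ∧ Function.Injective G ∧ (∀ a b, F a ≠ G b) ∧
      (∀ a, u (F a) = y a) ∧ (∀ a, u (G a) = x a) := by
  classical
  have hyx : ∀ a b, star (y a) ⬝ᵥ x b = 0 := fun a b => by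
    rw [star_dotProduct, hxy, star_zero]
  have inner_toLp : ∀ p q : ι → ℂ,
      ⟪(WithLp.toLp 2 p : EuclideanSpace ℂ ι), WithLp.toLp 2 q⟫_ℂ = star p ⬝ᵥ q := by
    intro p q
    rw [EuclideanSpace.inner_eq_star_dotProduct, dotProduct_comm]
  have toLp_inj : ∀ p q : ι → ℂ,
      (WithLp.toLp 2 p : EuclideanSpace ℂ ι) = WithLp.toLp 2 q → p = q :=
    fun p q h => congrArg WithLp.ofLp h
  -- injectivity / distinctness consequences of orthonormality
  have hx_inj : ∀ a b, x a = x b → a = b := by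
    intro a b h
    by_contra hab
    have h1 := hxx a b
    rw [if_neg hab, h, hxx b b, if_pos rfl] at h1
    exact one_ne_zero h1
  have hy_inj : ∀ a b, y a = y b → a = b := by
    intro a b h
    by_contra hab
    have h1 := hyy a b
    rw [if_neg hab, h, hyy b b, if_pos rfl] at h1
    exact one_ne_zero h1
  have hx_ne_y : ∀ a b, x a ≠ y b := by
    intro a b h
    have h1 := hxy a b
    rw [h, hyy b b, if_pos rfl] at h1
    exact one_ne_zero h1
  set S : Set (EuclideanSpace ℂ ι) :=
    Set.range (fun a => (WithLp.toLp 2 (x a) : EuclideanSpace ℂ ι)) ∪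
      Set.range (fun a => (WithLp.toLp 2 (y a) : EuclideanSpace ℂ ι)) with hS
  have hSo : Orthonormal ℂ (Subtype.val : S → EuclideanSpace ℂ ι) := by
    rw [orthonormal_subtype_iff_ite]
    intro p hp q hq
    rw [hS] at hp hq
    rcases hp with ⟨a, rfl⟩ | ⟨a, rfl⟩ <;> rcases hq with ⟨b, rfl⟩ | ⟨b, rfl⟩ <;> dsimp only
    · rw [inner_toLp, hxx]
      by_cases hab : a = b
      · subst hab; simp
      · rw [if_neg hab, if_neg (fun h => hab (hx_inj a b (toLp_inj _ _ h)))]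
    · rw [inner_toLp, hxy, if_neg (fun h => hx_ne_y a b (toLp_inj _ _ h))]
    · rw [inner_toLp, hyx, if_neg (fun h => hx_ne_y b a (toLp_inj _ _ h).symm)]
    · rw [inner_toLp, hyy]
      by_cases hab : a = b
      · subst hab; simp
      · rw [if_neg hab, if_neg (fun h => hab (hy_inj a b (toLp_inj _ _ h)))]
  obtain ⟨uF, b, hSU, hb⟩ := hSo.exists_orthonormalBasis_extension
  have hxmem : ∀ a, (WithLp.toLp 2 (x a) : EuclideanSpace ℂ ι) ∈ uF :=
    fun a => hSU (by rw [hS]; exact Set.mem_union_left _ ⟨a, rfl⟩)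
  have hymem : ∀ a, (WithLp.toLp 2 (y a) : EuclideanSpace ℂ ι) ∈ uF :=
    fun a => hSU (by rw [hS]; exact Set.mem_union_right _ ⟨a, rfl⟩)
  refine ⟨↥uF, inferInstance, inferInstance, fun k => WithLp.ofLp (k : EuclideanSpace ℂ ι),
    fun a => ⟨WithLp.toLp 2 (y a), hymem a⟩, fun a => ⟨WithLp.toLp 2 (x a), hxmem a⟩,
    ?_, ?_, ?_, ?_, ?_, fun a => rfl, fun a => rfl⟩
  · intro k l
    have h := (orthonormal_iff_ite.mp b.orthonormal) k l
    rw [hb, EuclideanSpace.inner_eq_star_dotProduct, dotProduct_comm] at h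
    exact h
  · rw [← finrank_euclideanSpace (𝕜 := ℂ) (ι := ι), Module.finrank_eq_card_basis b.toBasis]
  · intro a b h
    exact hy_inj a b (toLp_inj _ _ (congrArg Subtype.val h))
  · intro a b h
    exact hx_inj a b (toLp_inj _ _ (congrArg Subtype.val h))
  · intro a b h
    exact hx_ne_y b a (toLp_inj _ _ (congrArg Subtype.val h)).symm

end Extension

end Literature.MathematicalPhysics.QuantumLattice.RayleighBound

/-! ## The discharge -/

namespace Literature.MathematicalPhysics.QuantumLattice

open Matrix Finset RayleighBound
open scoped InnerProductSpace

section Main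

variable {ι : Type*} [LinearOrder ι] [Fintype ι]

/-- **Yang's bound** (discharge of `twoParticleRDM_rayleigh_le`): for every normalised
`N`-fermion state on `M` orbitals and every pair wavefunction `v`,
`Re ⟨v, ρ₂ v⟩ ≤ N(M - N + 2)/M · ‖v‖²`. The hypothesis `Even N` of the named fact is not used
(for odd `N` the bound holds but is not sharp). Proof: `⟨v, ρ₂ v⟩ = ‖Δ(v)ψ‖²`
(`star_dotProduct_twoParticleRDM_mulVec`); `Δ` only sees the antisymmetric part `a` of `v`
(CAR); Youla's normal form `a = Σ_α σ_α (ȳ_α ⊗ x̄_α - x̄_α ⊗ ȳ_α)`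
(`Matrix.exists_skewNormalForm_of_transpose_eq_neg`) gives `Δ(a) = 2 Σ_α σ_α c(x_α) c(y_α)`;
extending `(x_α, y_α)` to an orthonormal basis, the core estimate `normSq_pairSum_mulVec_le`
bounds `‖Σ_α σ_α c(x_α)c(y_α) ψ‖² ≤ N(M-N+2)/(2M) Σ_α σ_α²`, and `2 Σ_α σ_α² = ‖a‖² ≤ ‖v‖²`.
Yang, Rev. Mod. Phys. 34 (1962) 694, §3 and Appendix A (statement and strategy via the
canonical form of the pair function); the counting core follows Tennie–Vedral–Schilling,
Phys. Rev. B 96 (2017) 064502, App. A. [cite: YangODLRO1962, §3] -/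
theorem twoParticleRDM_rayleigh_le_holds : twoParticleRDM_rayleigh_le (ι := ι) := by
  classical
  intro N hN hNM ψ hψ hnorm v
  have hLHS : (star v ⬝ᵥ (twoParticleRDM ψ *ᵥ v)).re =
      normSq (pairOp (fun k l => v (k, l)) *ᵥ ψ) := by
    rw [star_dotProduct_twoParticleRDM_mulVec, star_dotProduct_self_eq_normSq, Complex.ofReal_re]
  have hvv : (star v ⬝ᵥ v).re = ∑ k, ∑ l, ‖v (k, l)‖ ^ 2 := by
    rw [Matrix.star_dotProduct_self_eq_ofReal, Complex.ofReal_re, Fintype.sum_prod_type]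
  have hcoef : 0 ≤ (N : ℝ) * (Fintype.card ι - N + 2 : ℝ) / Fintype.card ι := by
    apply div_nonneg (mul_nonneg (Nat.cast_nonneg N) ?_) (Nat.cast_nonneg _)
    have : (N : ℝ) ≤ Fintype.card ι := by exact_mod_cast hNM
    linarith
  have hRHS0 : 0 ≤ (N : ℝ) * (Fintype.card ι - N + 2 : ℝ) / Fintype.card ι * (star v ⬝ᵥ v).re := by
    rw [hvv]
    exact mul_nonneg hcoef
      (Finset.sum_nonneg fun k _ => Finset.sum_nonneg fun l _ => by positivity)
  rw [hLHS]
  rcases Nat.lt_or_ge N 2 with hN2 | hN2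
  · -- fewer than two particles: `Δ ψ = 0`
    have h0 : pairOp (fun k l => v (k, l)) *ᵥ ψ = 0 := by
      rw [pairOp, Matrix.sum_mulVec]
      refine Finset.sum_eq_zero fun k _ => ?_
      rw [Matrix.sum_mulVec]
      refine Finset.sum_eq_zero fun l _ => ?_
      rw [Matrix.smul_mulVec]
      have h1 : (annihilation l * annihilation k) *ᵥ ψ = 0 := by
        funext s
        rw [annihilation_mul_annihilation_mulVec_apply, Pi.zero_apply]
        split_ifs with h
        · have hk : k ∉ insert l s := by
            rw [Finset.mem_insert, not_or]
            exact ⟨fun e => h.2.2 e.symm, h.2.1⟩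
          rw [hψ _ (by rw [Finset.card_insert_of_notMem hk, Finset.card_insert_of_notMem h.1]; omega),
            mul_zero]
        · rfl
      rw [h1, smul_zero]
    rw [h0]
    simpa [normSq] using hRHS0
  · obtain ⟨m, rfl⟩ : ∃ m, N = m + 2 := ⟨N - 2, by omega⟩
    -- the antisymmetric part of `v` and its normal form
    set aM : Matrix ι ι ℂ := Matrix.of fun k l => (v (k, l) - v (l, k)) / 2 with haM
    have haMt : aMᵀ = -aM := by
      ext k l
      simp only [haM, Matrix.transpose_apply, Matrix.of_apply, Matrix.neg_apply]
      ring
    have hPa : pairOp (fun k l => v (k, l)) = pairOp (fun k l => aM k l) :=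
      pairOp_eq_pairOp_antisymm _
    obtain ⟨n, x, y, σ, -, hxx, hyy, hxy, -, haMeq⟩ :=
      Matrix.exists_skewNormalForm_of_transpose_eq_neg aM haMt
    have hakl : ∀ k l, aM k l =
        ∑ a, (σ a : ℂ) * (star (y a k) * star (x a l) - star (x a k) * star (y a l)) := by
      intro k l
      rw [haMeq]
      simp only [Matrix.sum_apply, Matrix.smul_apply, Matrix.sub_apply, vecMulVec_apply,
        Pi.star_apply, smul_eq_mul]
    -- `Δ(a) = 2 Σ_a σ_a c(x_a) c(y_a)`
    set Bop : Matrix (Finset ι) (Finset ι) ℂ :=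
      ∑ a, (σ a : ℂ) • (annihilate (x a) * annihilate (y a)) with hBop
    have hPn : pairOp (fun k l => aM k l) = (2 : ℂ) • Bop := by
      have hfun : (fun k l => aM k l) = ∑ a, (σ a : ℂ) •
          ((fun k l => star (y a k) * star (x a l)) - (fun k l => star (x a k) * star (y a l))) := by
        funext k l
        rw [hakl]
        simp only [Finset.sum_apply, Pi.smul_apply, Pi.sub_apply, smul_eq_mul]
      rw [hfun, pairOp_sum, hBop, Finset.smul_sum]
      refine Finset.sum_congr rfl fun a _ => ?_
      rw [pairOp_smul, pairOp_sub, pairOp_mul_fun, pairOp_mul_fun,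
        annihilate_mul_annihilate (y a) (x a), sub_neg_eq_add, ← two_smul ℂ, smul_comm]
    -- orthonormal basis extension and the core estimate
    obtain ⟨κ, instF, instD, u, F, G, hu, hcard, hF, hG, hFG, huF, huG⟩ :=
      exists_orthonormal_extension x y hxx hyy hxy
    have hu' := complete_of_orthonormal u hu hcard
    have core := normSq_pairSum_mulVec_le u F G hu hu' hF hG hFG (fun a => (σ a : ℂ)) hψ
    simp only [huF, huG] at core
    rw [hcard] at core
    -- numerical facts
    have hnorm1 : normSq ψ = 1 := by
      have h := star_dotProduct_self_eq_normSq ψ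
      rw [hnorm] at h
      exact_mod_cast h.symm
    have hσnorm : ∑ a, ‖(σ a : ℂ)‖ ^ 2 = ∑ a, σ a ^ 2 :=
      Finset.sum_congr rfl fun a _ => by rw [Complex.norm_real, Real.norm_eq_abs, sq_abs]
    have hL : normSq (pairOp (fun k l => v (k, l)) *ᵥ ψ) = 4 * normSq (Bop *ᵥ ψ) := by
      rw [hPa, hPn, Matrix.smul_mulVec, normSq_smul]
      norm_num
    have hfrob : 2 * ∑ a, σ a ^ 2 ≤ ∑ k, ∑ l, ‖v (k, l)‖ ^ 2 := by
      rw [← sum_norm_sq_skewNormalForm x y σ hxx hyy hxy]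
      calc _ = ∑ k, ∑ l, ‖(v (k, l) - v (l, k)) / 2‖ ^ 2 := by
            refine Finset.sum_congr rfl fun k _ => Finset.sum_congr rfl fun l _ => ?_
            rw [← hakl k l]
            rfl
        _ ≤ _ := sum_norm_sq_antisymm_le _
    have key : 4 * normSq (Bop *ᵥ ψ) ≤
        ((m + 2 : ℕ) : ℝ) * (Fintype.card ι - ((m + 2 : ℕ) : ℝ) + 2) / Fintype.card ι *
          (2 * ∑ a, σ a ^ 2) := by
      have h := mul_le_mul_of_nonneg_left core (by norm_num : (0 : ℝ) ≤ 4)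
      rw [hσnorm, hnorm1, mul_one] at h
      calc _ ≤ _ := h
        _ = _ := by push_cast; ring
    calc normSq (pairOp (fun k l => v (k, l)) *ᵥ ψ) = 4 * normSq (Bop *ᵥ ψ) := hL
      _ ≤ _ := key
      _ ≤ ((m + 2 : ℕ) : ℝ) * (Fintype.card ι - ((m + 2 : ℕ) : ℝ) + 2) / Fintype.card ι *
            ∑ k, ∑ l, ‖v (k, l)‖ ^ 2 := mul_le_mul_of_nonneg_left hfrob hcoef
      _ = _ := by rw [hvv]

end Main

end Literature.MathematicalPhysics.QuantumLattice
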